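import Summits.QuantumFields.YangMills.Theorems.BalabanUVNodesN15CovariantLandauTwoGridGreen
import HarnessLib

/-!
# Route «BalabanUVNodes», node N15 = NE2, road (c) — PROGRAMME (P-S), XXX: THE TWO-GRID η-DEFECT OF THE FLAT GRADIENT OF THE COVARIANT `G′(T)` (`∂G′(T)`) — via the SCALAR fixed point
# `Z = (Bᵀ − ℭ_N)∂G′(T)` whose step carries the BACKWARD-gradient kernel `S̄ₕ∂G′(1)`; flat inputs: the two-grid rows of `∂G′(1)` and `S̄ₕ∂G′(1)` (dag-n15-c g24, n15-c∕237; HOME HANDOFF «(G3)»)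

Cell `pub-ymgap`, seat `pub-ymgap-dag-n15-c` (generation g24; R134 (a), s1; HUMAN RULING D-0062; chair R424 venue).  `bears_on: R4∕N15 · K3⁸ SpineGivenEndpointR13SepCoPHV
(stmt-QuantumFields-27366)`; filed `--supports stmt-QuantumFields-27366 --as helper` — COUNT-NEUTRAL.  One definition (`bBack`), theorems; 0 `sorry`.  Imports BY NAME n15-c∕235 (`idef_sDiag`, `idef_bContr`,
`hasMaj_sDiag_pull`, `hasMaj_bContr_pull`), 236 (`rows_mLetter_le`), 236a (`cGreen_eq_one_add_step_mul`, `bMulShift_transpose_mul_bMulShift`), 224–229 (local operators, rows, `cgrad_one_transpose_comp_B`),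
215, lit-balaban∕b11 (`neumann_majorant`, `hasMaj_comp_exp`), the T⁴ cell (`idef_fix`, `idef_comp`).  Nothing in the tree is modified.

THE MECHANISM (n15-c∕229 one grid: `∂G′(T) = S₂ + ∂G′(1)(Bᵀ − ℭ_N)∂G′(T)`; two grids: the step `∂G′(1)(Bᵀ − ℭ_N)` contains the SHIFTED `Bᵀ = ℭ_Ñ S̄ₕ` (`Ñ_μ(z) = N_μ(z − e_μ)ᵀ`, `S̄ₕ` = `bBack`, the back shift
of bond fields along their own direction), whose intertwining defect on a general bond field costs a derivative — fatal on gradients.  CURE: the SCALAR unknown `Z = (Bᵀ − ℭ_N)∂G′(T)`: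
`∂G′(T) = S₂ + ∂G′(1)·Z`, `Z = S_Z + K_Z·Z`, `K_Z = (Bᵀ − ℭ_N)∂G′(1) = ℭ_Ñ[S̄ₕ∂G′(1)] − ℭ_N[∂G′(1)]` — the shift is GLUED to the flat kernel (the backward gradient of `G′(1)`), so every two-grid
defect is again (unshifted multiplier's oscillation after a pull-back) + (FLAT two-grid kernel row), n15-c∕235's calculus; `T4EtaRateDefect.idef_fix` + `neumann_majorant` give `𝔇(Z′, Z)`, and
`𝔇(∂G′(T)′, ∂G′(T)) = 𝔇(S₂′, S₂) + ∂G′(1)′·𝔇(Z′, Z) + 𝔇(∂G′(1)′, ∂G′(1))·Z`.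
* §1 `bBack`, `bBack_mulVec`, ★ `bMulShift_transpose_mulVec_eq` ∕ `mulVecLin_bMulShift_transpose` (`(𝔇_NS)ᵀ = ℭ_Ñ·S̄ₕ`);
* §2 ★★★ **`hasMaj_idef_cgrad_cGreen_of_flat`**: `∂′G′(T′)P̂_S − P̂_V∂G′(T) ≤ E_D·e^{−(δ−3s)d}`, `E_D` explicit (docstring), from: coarse rows `C_X, C_Y` (228∕229), flat kernel rows `C_D, C_D̄` (`∂G′(1)`,
  `S̄ₕ∂G′(1)`) on both grids, the two-grid defect `ε_X` of `G′(T)` (n15-c∕236), FLAT two-grid rows `ε_D, ε_D̄` of `∂G′(1)`, `S̄ₕ∂G′(1)`, oscillation letters `ω_N` (of `N′ − N∘pr` and of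
  `Ñ′ − Ñ∘pr`), `ω_V` (of `div_n N`), `ω_m`, the averaging word's row `φ_Q`, transporter letters, smallness `θ′_Zc < 1`, `θ′_Z = (d+1)(n′ρ₁)(C_D̄′ + C_D′)`.

HONEST FRAMING ∕ LIMITS.  Bookkeeping over displayed rows; the flat kernel rows (one- and two-grid) are HYPOTHESES (the located flat analytic input of (G3)); MODEL carriers; NOT
[Balaban1985BackgroundPropagators] Lemma 3.3 ∕ Thm 3.4 ∕ (3.49) as printed; NE2⁺ NOT PRINTED; N15 of record untouched (DISCHARGED AS CONSUMED, p687738); counts UNMOVED (typed 28∕28 · discharged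
8∕27); one finite 𝕋⁴ at fixed ε per index — NOT infinite volume ∕ OS ∕ mass gap ∕ Clay.  Restate-immune.
-/

noncomputable section

open scoped BigOperators Matrix
open Finset

namespace Summit.QuantumFields.YangMills.BalabanUVNodes.N15.CovLandau

open Literature.MathematicalPhysics.QuantumFieldTheory.Balaban1983to89
open Literature.MathematicalPhysics.QuantumFieldTheory.Balaban1983to89.B5Prop11Plancherel (Tor fine unitVec)
open Literature.MathematicalPhysics.QuantumFieldTheory.Balaban1983to89.B11SectG (BlockNorm HasMaj RowSum hasMaj_comp_exp neumann_majorant)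
open Literature.MathematicalPhysics.QuantumFieldTheory.Balaban1983to89.B6UnitTorusCarrier (unitTorusGeo rowSum_unitTorusGeo triangle254_unitTorusGeo unitTorusGeo_dist_nonneg)
open Literature.MathematicalPhysics.QuantumFieldTheory.Balaban1983to89.T4EtaRateDefect (idef idef_apply idef_comp idef_add idef_sub idef_fix)
open Literature.MathematicalPhysics.QuantumFieldTheory.Balaban1983to89.T4EtaRateCoeffDefect (pull pull_apply)
open Literature.MathematicalPhysics.QuantumFieldTheory.King1986.Torus (blockOf tdistT tdistT_nonneg tdistT_symm tdistT_self)
open Summit.QuantumFields.YangMills.BalabanUVNodes.N15.MatrixSpecies (liftBlk liftMap)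
open Summit.QuantumFields.YangMills.BalabanUVNodes.N15.VectorPiece (kingPr kingPrV)
open Summit.QuantumFields.YangMills.BalabanUVNodes.N15.CovAvg (cvaStair cvaStair_one)
open Summit.QuantumFields.YangMills.BalabanUVNodes.N15.BackgroundModel (kappa_ofBlocks)
open Summit.QuantumFields.YangMills.BalabanUVNodes.N15.DerivDefect (exists_const_hasMaj_ofBlocks)
open Summit.QuantumFields.YangMills.BalabanUVNodes.N15.TwoGrid (hasMaj_smul_ofBlocks)
open Summit.QuantumFields.YangMills.BalabanUVNodes.N15.BlockRows (hasMaj_comp_localRight hasMaj_comp_localLeft)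

variable {d : ℕ}

/-! ## §1 The back shift of bond fields and `(𝔇_NS)ᵀ = ℭ_Ñ·S̄ₕ` -/

section Back

variable (M : Fin (d + 1) → ℕ) [∀ μ, NeZero (M μ)] (n : ℕ) [NeZero n] {ι : Type} [Fintype ι] [DecidableEq ι]

/-- THE BACK SHIFT of bond fields along their own direction: `(S̄ₕω)((z, μ), i) = ω((z − e_μ, μ), i)`. [folklore] -/
def bBack : Matrix ((Tor (fine n M) × Fin (d + 1)) × ι) ((Tor (fine n M) × Fin (d + 1)) × ι) ℝ :=
  fun p q => if q = ((p.1.1 - unitVec (fine n M) p.1.2, p.1.2), p.2) then 1 else 0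

/-- `S̄ₕ` pointwise. [folklore] -/
theorem bBack_mulVec (ω : (Tor (fine n M) × Fin (d + 1)) × ι → ℝ) (z : Tor (fine n M)) (μ : Fin (d + 1)) (i : ι) :
    (bBack M n *ᵥ ω) ((z, μ), i) = ω ((z - unitVec (fine n M) μ, μ), i) := by
  simp only [Matrix.mulVec, dotProduct, bBack, ite_mul, one_mul, zero_mul]
  rw [Finset.sum_ite_eq' Finset.univ]
  simp

/-- ★ `(𝔇_NS)ᵀ = ℭ_Ñ·S̄ₕ` on fields, `Ñ_μ(z) = N_μ(z − e_μ)ᵀ`: the transposed shifted multiplier is an UNSHIFTED contraction after the back shift. [folklore] -/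
theorem bMulShift_transpose_mulVec_eq (N : Fin (d + 1) → Tor (fine n M) → Matrix ι ι ℝ) (ω : (Tor (fine n M) × Fin (d + 1)) × ι → ℝ) :
    (bMulShift M n N)ᵀ *ᵥ ω = bContr M n (fun μ z => (N μ (z - unitVec (fine n M) μ))ᵀ) *ᵥ (bBack M n *ᵥ ω) := by
  funext q
  obtain ⟨z, i⟩ := q
  rw [bMulShift_transpose_mulVec, bContr_mulVec]
  refine Finset.sum_congr rfl fun μ _ => Finset.sum_congr rfl fun j _ => ?_
  rw [bBack_mulVec, Matrix.transpose_apply]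

/-- The same as linear maps: `(𝔇_NS)ᵀ = ℭ_Ñ ∘ S̄ₕ`. [folklore] -/
theorem mulVecLin_bMulShift_transpose (N : Fin (d + 1) → Tor (fine n M) → Matrix ι ι ℝ) :
    Matrix.mulVecLin (bMulShift M n N)ᵀ = Matrix.mulVecLin (bContr M n (fun μ z => (N μ (z - unitVec (fine n M) μ))ᵀ)) ∘ₗ Matrix.mulVecLin (bBack M n) :=
  LinearMap.ext fun ω => by simp only [LinearMap.comp_apply, Matrix.mulVecLin_apply, bMulShift_transpose_mulVec_eq]

end Back

/-! ## §2 The two-grid η-defect of `∂G′(T)` -/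

section Defect

variable (M : Fin (d + 1) → ℕ) [∀ μ, NeZero (M μ)] {ι : Type} [Fintype ι] [DecidableEq ι] (L k m : ℕ) [NeZero L]

set_option maxHeartbeats 2400000 in
/-- ★★★ **THE TWO-GRID η-DEFECT OF `∂G′(T)` (flat gradient of the covariant scalar propagator) FROM FLAT TWO-GRID KERNEL ROWS, THE DEFECT OF `G′(T)`, OSCILLATION LETTERS AND ONE-GRID ROWS.**
Coarse `n = L^k` (`T`, `a`), fine `n′ = L^mL^k` (`T′`, `a′`); all input rows at the rate `δ`; `N = n(1 − T)`, `Ñ_μ = N_μ(· − e_μ)ᵀ`, `m = Σ_μ ÑᵀÑ`-type multiplier of `BᵀB`, `𝒬 = Q₁ᵀQ₁ − Q_TᵀQ_T`.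
Output: `∂′G′(T′)P̂_S − P̂_V∂G′(T) ≤ E_D·e^{−(δ−3s)d}` with
`E_D = ε_D + C_D′E_Wc + ε_D(w_WC_X)c + C_D′E_Z(1 − θ′_Zc)⁻¹c + ε_DC_Zc`, `E_W = w′_Wε_X + (ω_V + ω_m + φ_Q)C_X`, `w_W = (d+1)n(nλ) + (d+1)(nρ)² + |a|n^{−(d+1)}(στ+σ)` (and primed),
`E_Z = E_K + θ′_ZE_Wc + E_K(w_WC_X)c + E_KC_Zc`, `E_K = (d+1)[(n′ρ₁)(ε_D̄ + ε_D) + ω_N(C_D̄ + C_D)]`, `C_Z = (n(d+1)ρe^{δ+s})C_Yc + (d+1)(nρ)C_Y`, `θ′_Z = (d+1)(n′ρ₁)(C_D̄′ + C_D′)`.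
[cite: Balaban1985BackgroundPropagators, Thm 3.4 p.400 + Lemma 3.3 (3.55)–(3.62) p.402, Thm 3.14 pp.426–427 (mechanism); King1986, p.664 + Prop. 3.9 (3.73) p.665 (pairing, shape); Balaban1985Variational, (187)–(190) p.308] -/
theorem hasMaj_idef_cgrad_cGreen_of_flat
    {T : Fin (d + 1) → Tor (fine (L ^ k) M) → Matrix ι ι ℝ} (hT : ∀ ν x, IsUnit (T ν x)) {a : ℝ} (ha : 0 < a)
    {T' : Fin (d + 1) → Tor (fine (L ^ m * L ^ k) M) → Matrix ι ι ℝ} (hT' : ∀ ν x, IsUnit (T' ν x)) {a' : ℝ} (ha' : 0 < a')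
    {δ s c CX CY CD CDb CD₁ CDb₁ ρ lam σ τ ρ₁ lam₁ σ₁ τ₁ εX εD εDb ωN ωV ωm φQ : ℝ} (hs : 0 < s) (hsδ : 3 * s ≤ δ) (hrow : RowSum (unitTorusGeo L k M) s c) (hc : 0 ≤ c)
    (hCX : 0 ≤ CX) (hCY : 0 ≤ CY) (hCD : 0 ≤ CD) (hCDb : 0 ≤ CDb) (hCD₁ : 0 ≤ CD₁) (hCDb₁ : 0 ≤ CDb₁)
    (hρ0 : 0 ≤ ρ) (hlam0 : 0 ≤ lam) (hσ0 : 0 ≤ σ) (hτ0 : 0 ≤ τ) (hρ₁0 : 0 ≤ ρ₁) (hlam₁0 : 0 ≤ lam₁) (hσ₁0 : 0 ≤ σ₁) (hτ₁0 : 0 ≤ τ₁)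
    (hεX : 0 ≤ εX) (hεD : 0 ≤ εD) (hεDb : 0 ≤ εDb) (hωN0 : 0 ≤ ωN) (hωV0 : 0 ≤ ωV) (hωm0 : 0 ≤ ωm) (hφQ0 : 0 ≤ φQ)
    -- coarse transporter letters
    (hρr : ∀ ν x i, ∑ j, |(T ν x - (fun (_ : Fin (d + 1)) (_ : Tor (fine (L ^ k) M)) => (1 : Matrix ι ι ℝ)) ν x) i j| ≤ ρ)
    (hρc : ∀ ν x j, ∑ i, |(T ν x - (fun (_ : Fin (d + 1)) (_ : Tor (fine (L ^ k) M)) => (1 : Matrix ι ι ℝ)) ν x) i j| ≤ ρ)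
    (hlamr : ∀ μ (z : Tor (fine (L ^ k) M)) i, ∑ j, |(T μ z - T μ (z - unitVec (fine (L ^ k) M) μ)) i j| ≤ lam)
    (hσr : ∀ y aa i, ∑ j, |(cvaStair M (L ^ k) (fun μ b => T μ b.1) y aa 0 - cvaStair M (L ^ k) (fun μ b => (fun (_ : Fin (d + 1)) (_ : Tor (fine (L ^ k) M)) => (1 : Matrix ι ι ℝ)) μ b.1) y aa 0) i j| ≤ σ)
    (hσc : ∀ y aa j, ∑ i, |(cvaStair M (L ^ k) (fun μ b => T μ b.1) y aa 0 - cvaStair M (L ^ k) (fun μ b => (fun (_ : Fin (d + 1)) (_ : Tor (fine (L ^ k) M)) => (1 : Matrix ι ι ℝ)) μ b.1) y aa 0) i j| ≤ σ)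
    (hτr : ∀ y aa i, ∑ j, |cvaStair M (L ^ k) (fun μ b => T μ b.1) y aa 0 i j| ≤ τ)
    -- fine transporter letters
    (hρr' : ∀ ν x i, ∑ j, |(T' ν x - (fun (_ : Fin (d + 1)) (_ : Tor (fine (L ^ m * L ^ k) M)) => (1 : Matrix ι ι ℝ)) ν x) i j| ≤ ρ₁)
    (hρc' : ∀ ν x j, ∑ i, |(T' ν x - (fun (_ : Fin (d + 1)) (_ : Tor (fine (L ^ m * L ^ k) M)) => (1 : Matrix ι ι ℝ)) ν x) i j| ≤ ρ₁)
    (hlamr' : ∀ μ (z : Tor (fine (L ^ m * L ^ k) M)) i, ∑ j, |(T' μ z - T' μ (z - unitVec (fine (L ^ m * L ^ k) M) μ)) i j| ≤ lam₁)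
    (hσr' : ∀ y aa i, ∑ j, |(cvaStair M (L ^ m * L ^ k) (fun μ b => T' μ b.1) y aa 0 - cvaStair M (L ^ m * L ^ k) (fun μ b => (fun (_ : Fin (d + 1)) (_ : Tor (fine (L ^ m * L ^ k) M)) => (1 : Matrix ι ι ℝ)) μ b.1) y aa 0) i j| ≤ σ₁)
    (hσc' : ∀ y aa j, ∑ i, |(cvaStair M (L ^ m * L ^ k) (fun μ b => T' μ b.1) y aa 0 - cvaStair M (L ^ m * L ^ k) (fun μ b => (fun (_ : Fin (d + 1)) (_ : Tor (fine (L ^ m * L ^ k) M)) => (1 : Matrix ι ι ℝ)) μ b.1) y aa 0) i j| ≤ σ₁)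
    (hτr' : ∀ y aa i, ∑ j, |cvaStair M (L ^ m * L ^ k) (fun μ b => T' μ b.1) y aa 0 i j| ≤ τ₁)
    -- coarse propagator rows (n15-c∕228, 229) and flat kernel rows
    (hX : HasMaj (BlockNorm.ofBlocks (unitTorusGeo L k M) (liftBlk (blockOf (L ^ k) M) ι)) (BlockNorm.ofBlocks (unitTorusGeo L k M) (liftBlk (blockOf (L ^ k) M) ι)) (Matrix.mulVecLin (cGreen M (L ^ k) T a)) (fun y y' => CX * Real.exp (-(δ * tdistT M y y'))))
    (hY : HasMaj (BlockNorm.ofBlocks (unitTorusGeo L k M) (liftBlk (blockOf (L ^ k) M) ι)) (BlockNorm.ofBlocks (unitTorusGeo L k M) (liftBlk (fun b : Tor (fine (L ^ k) M) × Fin (d + 1) => blockOf (L ^ k) M b.1) ι)) (Matrix.mulVecLin ((cgrad M (L ^ k) (fun (_ : Fin (d + 1)) (_ : Tor (fine (L ^ k) M)) => (1 : Matrix ι ι ℝ))) * (cGreen M (L ^ k) T a))) (fun y y' => CY * Real.exp (-(δ * tdistT M y y'))))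
    (hD1 : HasMaj (BlockNorm.ofBlocks (unitTorusGeo L k M) (liftBlk (blockOf (L ^ k) M) ι)) (BlockNorm.ofBlocks (unitTorusGeo L k M) (liftBlk (fun b : Tor (fine (L ^ k) M) × Fin (d + 1) => blockOf (L ^ k) M b.1) ι)) (Matrix.mulVecLin ((cgrad M (L ^ k) (fun (_ : Fin (d + 1)) (_ : Tor (fine (L ^ k) M)) => (1 : Matrix ι ι ℝ))) * (cGreen M (L ^ k) (fun (_ : Fin (d + 1)) (_ : Tor (fine (L ^ k) M)) => (1 : Matrix ι ι ℝ)) a))) (fun y y' => CD * Real.exp (-(δ * tdistT M y y'))))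
    (hD1b : HasMaj (BlockNorm.ofBlocks (unitTorusGeo L k M) (liftBlk (blockOf (L ^ k) M) ι)) (BlockNorm.ofBlocks (unitTorusGeo L k M) (liftBlk (fun b : Tor (fine (L ^ k) M) × Fin (d + 1) => blockOf (L ^ k) M b.1) ι)) (Matrix.mulVecLin ((bBack M (L ^ k) (ι := ι)) * ((cgrad M (L ^ k) (fun (_ : Fin (d + 1)) (_ : Tor (fine (L ^ k) M)) => (1 : Matrix ι ι ℝ))) * (cGreen M (L ^ k) (fun (_ : Fin (d + 1)) (_ : Tor (fine (L ^ k) M)) => (1 : Matrix ι ι ℝ)) a)))) (fun y y' => CDb * Real.exp (-(δ * tdistT M y y'))))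
    -- fine flat kernel rows
    (hD1' : HasMaj (BlockNorm.ofBlocks (unitTorusGeo L k M) (liftBlk (blockOf (L ^ m * L ^ k) M) ι)) (BlockNorm.ofBlocks (unitTorusGeo L k M) (liftBlk (fun b : Tor (fine (L ^ m * L ^ k) M) × Fin (d + 1) => blockOf (L ^ m * L ^ k) M b.1) ι)) (Matrix.mulVecLin ((cgrad M (L ^ m * L ^ k) (fun (_ : Fin (d + 1)) (_ : Tor (fine (L ^ m * L ^ k) M)) => (1 : Matrix ι ι ℝ))) * (cGreen M (L ^ m * L ^ k) (fun (_ : Fin (d + 1)) (_ : Tor (fine (L ^ m * L ^ k) M)) => (1 : Matrix ι ι ℝ)) a'))) (fun y y' => CD₁ * Real.exp (-(δ * tdistT M y y'))))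
    (hD1b' : HasMaj (BlockNorm.ofBlocks (unitTorusGeo L k M) (liftBlk (blockOf (L ^ m * L ^ k) M) ι)) (BlockNorm.ofBlocks (unitTorusGeo L k M) (liftBlk (fun b : Tor (fine (L ^ m * L ^ k) M) × Fin (d + 1) => blockOf (L ^ m * L ^ k) M b.1) ι)) (Matrix.mulVecLin ((bBack M (L ^ m * L ^ k) (ι := ι)) * ((cgrad M (L ^ m * L ^ k) (fun (_ : Fin (d + 1)) (_ : Tor (fine (L ^ m * L ^ k) M)) => (1 : Matrix ι ι ℝ))) * (cGreen M (L ^ m * L ^ k) (fun (_ : Fin (d + 1)) (_ : Tor (fine (L ^ m * L ^ k) M)) => (1 : Matrix ι ι ℝ)) a')))) (fun y y' => CDb₁ * Real.exp (-(δ * tdistT M y y'))))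
    -- two-grid rows: the defect of `G′(T)` (n15-c∕236) and the FLAT kernel defects
    (hXG : HasMaj (BlockNorm.ofBlocks (unitTorusGeo L k M) (liftBlk (blockOf (L ^ k) M) ι)) (BlockNorm.ofBlocks (unitTorusGeo L k M) (liftBlk (blockOf (L ^ m * L ^ k) M) ι)) (idef (pull (liftMap (kingPr L k m M) ι)) (pull (liftMap (kingPr L k m M) ι)) (Matrix.mulVecLin (cGreen M (L ^ m * L ^ k) T' a')) (Matrix.mulVecLin (cGreen M (L ^ k) T a))) (fun y y' => εX * Real.exp (-(δ * tdistT M y y'))))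
    (hDD : HasMaj (BlockNorm.ofBlocks (unitTorusGeo L k M) (liftBlk (blockOf (L ^ k) M) ι)) (BlockNorm.ofBlocks (unitTorusGeo L k M) (liftBlk (fun b : Tor (fine (L ^ m * L ^ k) M) × Fin (d + 1) => blockOf (L ^ m * L ^ k) M b.1) ι)) (idef (pull (liftMap (kingPr L k m M) ι)) (pull (liftMap (kingPrV L k m M) ι)) (Matrix.mulVecLin ((cgrad M (L ^ m * L ^ k) (fun (_ : Fin (d + 1)) (_ : Tor (fine (L ^ m * L ^ k) M)) => (1 : Matrix ι ι ℝ))) * (cGreen M (L ^ m * L ^ k) (fun (_ : Fin (d + 1)) (_ : Tor (fine (L ^ m * L ^ k) M)) => (1 : Matrix ι ι ℝ)) a'))) (Matrix.mulVecLin ((cgrad M (L ^ k) (fun (_ : Fin (d + 1)) (_ : Tor (fine (L ^ k) M)) => (1 : Matrix ι ι ℝ))) * (cGreen M (L ^ k) (fun (_ : Fin (d + 1)) (_ : Tor (fine (L ^ k) M)) => (1 : Matrix ι ι ℝ)) a)))) (fun y y' => εD * Real.exp (-(δ * tdistT M y y'))))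
    (hDDb : HasMaj (BlockNorm.ofBlocks (unitTorusGeo L k M) (liftBlk (blockOf (L ^ k) M) ι)) (BlockNorm.ofBlocks (unitTorusGeo L k M) (liftBlk (fun b : Tor (fine (L ^ m * L ^ k) M) × Fin (d + 1) => blockOf (L ^ m * L ^ k) M b.1) ι)) (idef (pull (liftMap (kingPr L k m M) ι)) (pull (liftMap (kingPrV L k m M) ι)) (Matrix.mulVecLin ((bBack M (L ^ m * L ^ k) (ι := ι)) * ((cgrad M (L ^ m * L ^ k) (fun (_ : Fin (d + 1)) (_ : Tor (fine (L ^ m * L ^ k) M)) => (1 : Matrix ι ι ℝ))) * (cGreen M (L ^ m * L ^ k) (fun (_ : Fin (d + 1)) (_ : Tor (fine (L ^ m * L ^ k) M)) => (1 : Matrix ι ι ℝ)) a')))) (Matrix.mulVecLin ((bBack M (L ^ k) (ι := ι)) * ((cgrad M (L ^ k) (fun (_ : Fin (d + 1)) (_ : Tor (fine (L ^ k) M)) => (1 : Matrix ι ι ℝ))) * (cGreen M (L ^ k) (fun (_ : Fin (d + 1)) (_ : Tor (fine (L ^ k) M)) => (1 : Matrix ι ι ℝ)) a))))) (fun y y'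 => εDb * Real.exp (-(δ * tdistT M y y'))))
    -- oscillation letters
    (hωNr : ∀ ν x' i, ∑ j, |((fun ν x => (((L ^ m * L ^ k : ℕ) : ℝ)) • ((1 : Matrix ι ι ℝ) - T' ν x)) ν x' - (fun ν x => (((L ^ k : ℕ) : ℝ)) • ((1 : Matrix ι ι ℝ) - T ν x)) ν (kingPr L k m M x')) i j| ≤ ωN)
    (hωNt : ∀ μ x' i, ∑ j, |((fun μ z => ((((L ^ m * L ^ k : ℕ) : ℝ)) • ((1 : Matrix ι ι ℝ) - T' μ (z - unitVec (fine (L ^ m * L ^ k) M) μ)))ᵀ) μ x' - (fun μ z => ((((L ^ k : ℕ) : ℝ)) • ((1 : Matrix ι ι ℝ) - T μ (z - unitVec (fine (L ^ k) M) μ)))ᵀ) μ (kingPr L k m M x')) i j| ≤ ωN)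
    (hωV : ∀ x' i, ∑ j, |((bDiv M (L ^ m * L ^ k) (fun ν x => (((L ^ m * L ^ k : ℕ) : ℝ)) • ((1 : Matrix ι ι ℝ) - T' ν x))) x' - (bDiv M (L ^ k) (fun ν x => (((L ^ k : ℕ) : ℝ)) • ((1 : Matrix ι ι ℝ) - T ν x))) (kingPr L k m M x')) i j| ≤ ωV)
    (hωm : ∀ x' i, ∑ j, |((fun z => ∑ μ, ((fun ν x => (((L ^ m * L ^ k : ℕ) : ℝ)) • ((1 : Matrix ι ι ℝ) - T' ν x)) μ (z - unitVec (fine (L ^ m * L ^ k) M) μ))ᵀ * (fun ν x => (((L ^ m * L ^ k : ℕ) : ℝ)) • ((1 : Matrix ι ι ℝ) - T' ν x)) μ (z - unitVec (fine (L ^ m * L ^ k) M) μ)) x' - (fun z => ∑ μ, ((fun ν x => (((L ^ k : ℕ) : ℝ)) • ((1 : Matrix ι ι ℝ) - T ν x)) μ (z - unitVec (fine (L ^ k) M) μ))ᵀ * (fun ν x => (((L ^ k : ℕ) : ℝ)) • ((1 : Matrix ι ι ℝ) - T ν x)) μ (z - unitVec (fine (L ^ k) M) μ)) (kingPr L k m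 M x')) i j| ≤ ωm)
    (hDQ : HasMaj (BlockNorm.ofBlocks (unitTorusGeo L k M) (liftBlk (blockOf (L ^ k) M) ι)) (BlockNorm.ofBlocks (unitTorusGeo L k M) (liftBlk (blockOf (L ^ m * L ^ k) M) ι)) (idef (pull (liftMap (kingPr L k m M) ι)) (pull (liftMap (kingPr L k m M) ι)) (Matrix.mulVecLin (a' • (((csavg M (L ^ m * L ^ k) (fun (_ : Fin (d + 1)) (_ : Tor (fine (L ^ m * L ^ k) M)) => (1 : Matrix ι ι ℝ))))ᵀ * (csavg M (L ^ m * L ^ k) (fun (_ : Fin (d + 1)) (_ : Tor (fine (L ^ m * L ^ k) M)) => (1 : Matrix ι ι ℝ))) - ((csavg M (L ^ m * L ^ k) T'))ᵀ * (csavg M (L ^ m * L ^ k) T')))) (Matrix.mulVecLin (a • (((csavg M (L ^ k) (fun (_ : Fin (d + 1)) (_ : Tor (fine (L ^ k) M)) => (1 : Matrix ι ι ℝ))))ᵀ * (csavg M (L ^ k) (fun (_ : Fin (d + 1)) (_ : Tor (fine (L ^ k) M)) => (1 : Matrix ι ι ℝ))) - ((csavg M (L ^ k) T))ᵀ * (csavg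 M (L ^ k) T))))) (fun y y' => if y = y' then φQ else 0))
    -- smallness of the fine scalar step
    (hq' : (((d : ℝ) + 1) * ((((L ^ m * L ^ k : ℕ) : ℝ)) * ρ₁) * (CDb₁ + CD₁)) * c < 1) :
    HasMaj (BlockNorm.ofBlocks (unitTorusGeo L k M) (liftBlk (blockOf (L ^ k) M) ι)) (BlockNorm.ofBlocks (unitTorusGeo L k M) (liftBlk (fun b : Tor (fine (L ^ m * L ^ k) M) × Fin (d + 1) => blockOf (L ^ m * L ^ k) M b.1) ι)) (idef (pull (liftMap (kingPr L k m M) ι)) (pull (liftMap (kingPrV L k m M) ι)) (Matrix.mulVecLin ((cgrad M (L ^ m * L ^ k) (fun (_ : Fin (d + 1)) (_ : Tor (fine (L ^ m * L ^ k) M)) => (1 : Matrix ι ι ℝ))) * (cGreen M (L ^ m * L ^ k) T' a'))) (Matrix.mulVecLin ((cgrad M (L ^ k) (fun (_ : Fin (d + 1)) (_ : Tor (fine (L ^ k) M)) => (1 : Matrix ι ι ℝ))) * (cGreen M (L ^ k) T a))))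
      (fun y y' => (εD + CD₁ * ((((d : ℝ) + 1) * (((L ^ m * L ^ k : ℕ) : ℝ)) * ((((L ^ m * L ^ k : ℕ) : ℝ)) * lam₁) + ((d : ℝ) + 1) * (((((L ^ m * L ^ k : ℕ) : ℝ)) * ρ₁) * ((((L ^ m * L ^ k : ℕ) : ℝ)) * ρ₁)) + |a'| * (((((L ^ m * L ^ k : ℕ) : ℝ)) ^ (d + 1))⁻¹ * (σ₁ * τ₁ + σ₁))) * εX + (ωV + ωm + φQ) * CX) * c + εD * ((((d : ℝ) + 1) * (((L ^ k : ℕ) : ℝ)) * ((((L ^ k : ℕ) : ℝ)) * lam) + ((d : ℝ) + 1) * (((((L ^ k : ℕ) : ℝ)) * ρ) * ((((L ^ k : ℕ) : ℝ)) * ρ)) + |a| * (((((L ^ k : ℕ) : ℝ)) ^ (d + 1))⁻¹ * (σ * τ + σ))) * CX) * c + CD₁ * (((((d : ℝ) + 1) * ((((L ^ m * L ^ k : ℕ) : ℝ)) * ρ₁) * εDb + ((d : ℝ) + 1) * ωN * CDb + ((d : ℝ) + 1) * ((((L ^ m * L ^ k : ℕ) : ℝ)) * ρ₁) * εD + ((d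 : ℝ) + 1) * ωN * CD) + (((d : ℝ) + 1) * ((((L ^ m * L ^ k : ℕ) : ℝ)) * ρ₁) * (CDb₁ + CD₁)) * ((((d : ℝ) + 1) * (((L ^ m * L ^ k : ℕ) : ℝ)) * ((((L ^ m * L ^ k : ℕ) : ℝ)) * lam₁) + ((d : ℝ) + 1) * (((((L ^ m * L ^ k : ℕ) : ℝ)) * ρ₁) * ((((L ^ m * L ^ k : ℕ) : ℝ)) * ρ₁)) + |a'| * (((((L ^ m * L ^ k : ℕ) : ℝ)) ^ (d + 1))⁻¹ * (σ₁ * τ₁ + σ₁))) * εX + (ωV + ωm + φQ) * CX) * c + (((d : ℝ) + 1) * ((((L ^ m * L ^ k : ℕ) : ℝ)) * ρ₁) * εDb + ((d : ℝ) + 1) * ωN * CDb + ((d : ℝ) + 1) * ((((L ^ m * L ^ k : ℕ) : ℝ)) * ρ₁) * εD + ((d : ℝ) + 1) * ωN * CD) * ((((d : ℝ) + 1) * (((L ^ k : ℕ) : ℝ)) * ((((L ^ k : ℕ) : ℝ)) * lam) + ((d : ℝ) + 1) * (((((L ^ k : ℕ) : ℝ)) * ρ) * ((((L ^ k : ℕ)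 : ℝ)) * ρ)) + |a| * (((((L ^ k : ℕ) : ℝ)) ^ (d + 1))⁻¹ * (σ * τ + σ))) * CX) * c + (((d : ℝ) + 1) * ((((L ^ m * L ^ k : ℕ) : ℝ)) * ρ₁) * εDb + ((d : ℝ) + 1) * ωN * CDb + ((d : ℝ) + 1) * ((((L ^ m * L ^ k : ℕ) : ℝ)) * ρ₁) * εD + ((d : ℝ) + 1) * ωN * CD) * (((((L ^ k : ℕ) : ℝ)) * ((d + 1 : ℕ) * ρ) * Real.exp (δ + s)) * CY * c + (((d : ℝ) + 1) * ((((L ^ k : ℕ) : ℝ)) * ρ)) * CY) * c) * (1 - (((d : ℝ) + 1) * ((((L ^ m * L ^ k : ℕ) : ℝ)) * ρ₁) * (CDb₁ + CD₁)) * c)⁻¹) * c + εD * (((((L ^ k : ℕ) : ℝ)) * ((d + 1 : ℕ) * ρ) * Real.exp (δ + s)) * CY * c + (((d : ℝ) + 1) * ((((L ^ k : ℕ) : ℝ)) * ρ)) * CY) * c) * Real.exp (-((δ - 3 * s) * tdistT M y y'))) := by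
  have hn : (0 : ℝ) < (((L ^ k : ℕ) : ℝ)) ^ (d + 1) := pow_pos (Nat.cast_pos.mpr (Nat.pos_of_ne_zero (NeZero.ne _))) _
  have hn' : (0 : ℝ) < (((L ^ m * L ^ k : ℕ) : ℝ)) ^ (d + 1) := pow_pos (Nat.cast_pos.mpr (Nat.pos_of_ne_zero (NeZero.ne _))) _
  have hn1 : (0 : ℝ) ≤ (((L ^ k : ℕ) : ℝ)) := Nat.cast_nonneg _
  have hn1' : (0 : ℝ) ≤ (((L ^ m * L ^ k : ℕ) : ℝ)) := Nat.cast_nonneg _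
  have hδ : 0 ≤ δ := by linarith
  have htri := triangle254_unitTorusGeo L k M
  have hd := unitTorusGeo_dist_nonneg L k M
  have hκS : (BlockNorm.ofBlocks (unitTorusGeo L k M) (liftBlk (blockOf (L ^ k) M) ι)).κ = 1 := kappa_ofBlocks _
  have hκV : (BlockNorm.ofBlocks (unitTorusGeo L k M) (liftBlk (fun b : Tor (fine (L ^ k) M) × Fin (d + 1) => blockOf (L ^ k) M b.1) ι)).κ = 1 := kappa_ofBlocks _
  have hκS1 : (BlockNorm.ofBlocks (unitTorusGeo L k M) (liftBlk (blockOf (L ^ m * L ^ k) M) ι)).κ = 1 := kappa_ofBlocks _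
  have hκV1 : (BlockNorm.ofBlocks (unitTorusGeo L k M) (liftBlk (fun b : Tor (fine (L ^ m * L ^ k) M) × Fin (d + 1) => blockOf (L ^ m * L ^ k) M b.1) ι)).κ = 1 := kappa_ofBlocks _
  have hκU : (BlockNorm.ofBlocks (unitTorusGeo L k M) (liftBlk (fun y : Tor M => y) ι)).κ = 1 := kappa_ofBlocks _
  -- ### letters of `N`, `Ñ`, `div N`, `m` on both grids
  have hWr : ∀ μ x i, ∑ j, |(fun ν x => (((L ^ k : ℕ) : ℝ)) • ((1 : Matrix ι ι ℝ) - T ν x)) μ x i j| ≤ (((L ^ k : ℕ) : ℝ)) * ρ := by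
    intro μ x i
    have h := hρr μ x i
    calc ∑ j, |(fun ν x => (((L ^ k : ℕ) : ℝ)) • ((1 : Matrix ι ι ℝ) - T ν x)) μ x i j| = (((L ^ k : ℕ) : ℝ)) * ∑ j, |(T μ x - (fun (_ : Fin (d + 1)) (_ : Tor (fine (L ^ k) M)) => (1 : Matrix ι ι ℝ)) μ x) i j| := by
          rw [Finset.mul_sum]; refine Finset.sum_congr rfl fun j _ => ?_
          simp only [Matrix.smul_apply, smul_eq_mul, abs_mul, abs_of_nonneg hn1, Matrix.sub_apply, Matrix.one_apply]
          rw [abs_sub_comm]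
      _ ≤ (((L ^ k : ℕ) : ℝ)) * ρ := mul_le_mul_of_nonneg_left h hn1
  have hWc : ∀ μ x i, ∑ j, |(fun ν x => (((L ^ k : ℕ) : ℝ)) • ((1 : Matrix ι ι ℝ) - T ν x)) μ x j i| ≤ (((L ^ k : ℕ) : ℝ)) * ρ := by
    intro μ x i
    have h := hρc μ x i
    calc ∑ j, |(fun ν x => (((L ^ k : ℕ) : ℝ)) • ((1 : Matrix ι ι ℝ) - T ν x)) μ x j i| = (((L ^ k : ℕ) : ℝ)) * ∑ j, |(T μ x - (fun (_ : Fin (d + 1)) (_ : Tor (fine (L ^ k) M)) => (1 : Matrix ι ι ℝ)) μ x) j i| := by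
          rw [Finset.mul_sum]; refine Finset.sum_congr rfl fun j _ => ?_
          simp only [Matrix.smul_apply, smul_eq_mul, abs_mul, abs_of_nonneg hn1, Matrix.sub_apply, Matrix.one_apply]
          rw [abs_sub_comm]
      _ ≤ (((L ^ k : ℕ) : ℝ)) * ρ := mul_le_mul_of_nonneg_left h hn1
  have hWr' : ∀ μ x i, ∑ j, |(fun ν x => (((L ^ m * L ^ k : ℕ) : ℝ)) • ((1 : Matrix ι ι ℝ) - T' ν x)) μ x i j| ≤ (((L ^ m * L ^ k : ℕ) : ℝ)) * ρ₁ := by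
    intro μ x i
    have h := hρr' μ x i
    calc ∑ j, |(fun ν x => (((L ^ m * L ^ k : ℕ) : ℝ)) • ((1 : Matrix ι ι ℝ) - T' ν x)) μ x i j| = (((L ^ m * L ^ k : ℕ) : ℝ)) * ∑ j, |(T' μ x - (fun (_ : Fin (d + 1)) (_ : Tor (fine (L ^ m * L ^ k) M)) => (1 : Matrix ι ι ℝ)) μ x) i j| := by
          rw [Finset.mul_sum]; refine Finset.sum_congr rfl fun j _ => ?_
          simp only [Matrix.smul_apply, smul_eq_mul, abs_mul, abs_of_nonneg hn1', Matrix.sub_apply, Matrix.one_apply]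
          rw [abs_sub_comm]
      _ ≤ (((L ^ m * L ^ k : ℕ) : ℝ)) * ρ₁ := mul_le_mul_of_nonneg_left h hn1'
  have hWc' : ∀ μ x i, ∑ j, |(fun ν x => (((L ^ m * L ^ k : ℕ) : ℝ)) • ((1 : Matrix ι ι ℝ) - T' ν x)) μ x j i| ≤ (((L ^ m * L ^ k : ℕ) : ℝ)) * ρ₁ := by
    intro μ x i
    have h := hρc' μ x i
    calc ∑ j, |(fun ν x => (((L ^ m * L ^ k : ℕ) : ℝ)) • ((1 : Matrix ι ι ℝ) - T' ν x)) μ x j i| = (((L ^ m * L ^ k : ℕ) : ℝ)) * ∑ j, |(T' μ x - (fun (_ : Fin (d + 1)) (_ : Tor (fine (L ^ m * L ^ k) M)) => (1 : Matrix ι ι ℝ)) μ x) j i| := by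
          rw [Finset.mul_sum]; refine Finset.sum_congr rfl fun j _ => ?_
          simp only [Matrix.smul_apply, smul_eq_mul, abs_mul, abs_of_nonneg hn1', Matrix.sub_apply, Matrix.one_apply]
          rw [abs_sub_comm]
      _ ≤ (((L ^ m * L ^ k : ℕ) : ℝ)) * ρ₁ := mul_le_mul_of_nonneg_left h hn1'
  have hNTr : ∀ μ z i, ∑ j, |(fun μ z => ((((L ^ k : ℕ) : ℝ)) • ((1 : Matrix ι ι ℝ) - T μ (z - unitVec (fine (L ^ k) M) μ)))ᵀ) μ z i j| ≤ (((L ^ k : ℕ) : ℝ)) * ρ := fun μ z i => by simpa only [Matrix.transpose_apply] using hWc μ (z - unitVec (fine (L ^ k) M) μ) i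
  have hNTr' : ∀ μ z i, ∑ j, |(fun μ z => ((((L ^ m * L ^ k : ℕ) : ℝ)) • ((1 : Matrix ι ι ℝ) - T' μ (z - unitVec (fine (L ^ m * L ^ k) M) μ)))ᵀ) μ z i j| ≤ (((L ^ m * L ^ k : ℕ) : ℝ)) * ρ₁ := fun μ z i => by simpa only [Matrix.transpose_apply] using hWc' μ (z - unitVec (fine (L ^ m * L ^ k) M) μ) i
  have hWlam : ∀ μ (z : Tor (fine (L ^ k) M)) i, ∑ j, |((fun ν x => (((L ^ k : ℕ) : ℝ)) • ((1 : Matrix ι ι ℝ) - T ν x)) μ (z - unitVec (fine (L ^ k) M) μ) - (fun ν x => (((L ^ k : ℕ) : ℝ)) • ((1 : Matrix ι ι ℝ) - T ν x)) μ z) i j| ≤ (((L ^ k : ℕ) : ℝ)) * lam := by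
    intro μ z i
    have h := hlamr μ z i
    calc ∑ j, |((fun ν x => (((L ^ k : ℕ) : ℝ)) • ((1 : Matrix ι ι ℝ) - T ν x)) μ (z - unitVec (fine (L ^ k) M) μ) - (fun ν x => (((L ^ k : ℕ) : ℝ)) • ((1 : Matrix ι ι ℝ) - T ν x)) μ z) i j| = (((L ^ k : ℕ) : ℝ)) * ∑ j, |(T μ z - T μ (z - unitVec (fine (L ^ k) M) μ)) i j| := by
          rw [Finset.mul_sum]; refine Finset.sum_congr rfl fun j _ => ?_
          simp only [Matrix.smul_apply, smul_eq_mul, Matrix.sub_apply]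
          rw [← mul_sub, abs_mul, abs_of_nonneg hn1, sub_sub_sub_cancel_left]
      _ ≤ (((L ^ k : ℕ) : ℝ)) * lam := mul_le_mul_of_nonneg_left h hn1
  have hWlam' : ∀ μ (z : Tor (fine (L ^ m * L ^ k) M)) i, ∑ j, |((fun ν x => (((L ^ m * L ^ k : ℕ) : ℝ)) • ((1 : Matrix ι ι ℝ) - T' ν x)) μ (z - unitVec (fine (L ^ m * L ^ k) M) μ) - (fun ν x => (((L ^ m * L ^ k : ℕ) : ℝ)) • ((1 : Matrix ι ι ℝ) - T' ν x)) μ z) i j| ≤ (((L ^ m * L ^ k : ℕ) : ℝ)) * lam₁ := by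
    intro μ z i
    have h := hlamr' μ z i
    calc ∑ j, |((fun ν x => (((L ^ m * L ^ k : ℕ) : ℝ)) • ((1 : Matrix ι ι ℝ) - T' ν x)) μ (z - unitVec (fine (L ^ m * L ^ k) M) μ) - (fun ν x => (((L ^ m * L ^ k : ℕ) : ℝ)) • ((1 : Matrix ι ι ℝ) - T' ν x)) μ z) i j| = (((L ^ m * L ^ k : ℕ) : ℝ)) * ∑ j, |(T' μ z - T' μ (z - unitVec (fine (L ^ m * L ^ k) M) μ)) i j| := by
          rw [Finset.mul_sum]; refine Finset.sum_congr rfl fun j _ => ?_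
          simp only [Matrix.smul_apply, smul_eq_mul, Matrix.sub_apply]
          rw [← mul_sub, abs_mul, abs_of_nonneg hn1', sub_sub_sub_cancel_left]
      _ ≤ (((L ^ m * L ^ k : ℕ) : ℝ)) * lam₁ := mul_le_mul_of_nonneg_left h hn1'
  have hVr : ∀ z i, ∑ j, |(bDiv M (L ^ k) (fun ν x => (((L ^ k : ℕ) : ℝ)) • ((1 : Matrix ι ι ℝ) - T ν x))) z i j| ≤ ((d : ℝ) + 1) * (((L ^ k : ℕ) : ℝ)) * ((((L ^ k : ℕ) : ℝ)) * lam) := fun z i => rows_bDiv_le M (L ^ k) (fun ν x => (((L ^ k : ℕ) : ℝ)) • ((1 : Matrix ι ι ℝ) - T ν x)) hWlam z i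
  have hVr' : ∀ z i, ∑ j, |(bDiv M (L ^ m * L ^ k) (fun ν x => (((L ^ m * L ^ k : ℕ) : ℝ)) • ((1 : Matrix ι ι ℝ) - T' ν x))) z i j| ≤ ((d : ℝ) + 1) * (((L ^ m * L ^ k : ℕ) : ℝ)) * ((((L ^ m * L ^ k : ℕ) : ℝ)) * lam₁) := fun z i => rows_bDiv_le M (L ^ m * L ^ k) (fun ν x => (((L ^ m * L ^ k : ℕ) : ℝ)) • ((1 : Matrix ι ι ℝ) - T' ν x)) hWlam' z i
  have hmr : ∀ z i, ∑ j, |(fun z => ∑ μ, ((fun ν x => (((L ^ k : ℕ) : ℝ)) • ((1 : Matrix ι ι ℝ) - T ν x)) μ (z - unitVec (fine (L ^ k) M) μ))ᵀ * (fun ν x => (((L ^ k : ℕ) : ℝ)) • ((1 : Matrix ι ι ℝ) - T ν x)) μ (z - unitVec (fine (L ^ k) M) μ)) z i j| ≤ ((d : ℝ) + 1) * (((((L ^ k : ℕ) : ℝ)) * ρ) * ((((L ^ k : ℕ) : ℝ)) * ρ)) := fun z i => rows_mLetter_le M (L ^ k) (fun ν x => (((L ^ k : ℕ) : ℝ)) •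 ((1 : Matrix ι ι ℝ) - T ν x)) (by positivity) hWr hWc z i
  have hmr' : ∀ z i, ∑ j, |(fun z => ∑ μ, ((fun ν x => (((L ^ m * L ^ k : ℕ) : ℝ)) • ((1 : Matrix ι ι ℝ) - T' ν x)) μ (z - unitVec (fine (L ^ m * L ^ k) M) μ))ᵀ * (fun ν x => (((L ^ m * L ^ k : ℕ) : ℝ)) • ((1 : Matrix ι ι ℝ) - T' ν x)) μ (z - unitVec (fine (L ^ m * L ^ k) M) μ)) z i j| ≤ ((d : ℝ) + 1) * (((((L ^ m * L ^ k : ℕ) : ℝ)) * ρ₁) * ((((L ^ m * L ^ k : ℕ) : ℝ)) * ρ₁)) := fun z i => rows_mLetter_le M (L ^ m * L ^ k) (fun ν x => (((L ^ m * L ^ k : ℕ) : ℝ)) • ((1 : Matrix ι ι ℝ) - T' ν x)) (by positivity) hWr' hWc' z i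
  -- ### block-diagonal rows of the local operators
  have hSD := hasMaj_sDiag_if M (L ^ k) L k (bDiv M (L ^ k) (fun ν x => (((L ^ k : ℕ) : ℝ)) • ((1 : Matrix ι ι ℝ) - T ν x))) (by positivity) hVr
  have hSD' := hasMaj_sDiag_if M (L ^ m * L ^ k) L k (bDiv M (L ^ m * L ^ k) (fun ν x => (((L ^ m * L ^ k : ℕ) : ℝ)) • ((1 : Matrix ι ι ℝ) - T' ν x))) (by positivity) hVr'
  have hMD := hasMaj_sDiag_if M (L ^ k) L k (fun z => ∑ μ, ((fun ν x => (((L ^ k : ℕ) : ℝ)) • ((1 : Matrix ι ι ℝ) - T ν x)) μ (z - unitVec (fine (L ^ k) M) μ))ᵀ * (fun ν x => (((L ^ k : ℕ) : ℝ)) • ((1 : Matrix ι ι ℝ) - T ν x)) μ (z - unitVec (fine (L ^ k) M) μ)) (by positivity) hmr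
  have hMD' := hasMaj_sDiag_if M (L ^ m * L ^ k) L k (fun z => ∑ μ, ((fun ν x => (((L ^ m * L ^ k : ℕ) : ℝ)) • ((1 : Matrix ι ι ℝ) - T' ν x)) μ (z - unitVec (fine (L ^ m * L ^ k) M) μ))ᵀ * (fun ν x => (((L ^ m * L ^ k : ℕ) : ℝ)) • ((1 : Matrix ι ι ℝ) - T' ν x)) μ (z - unitVec (fine (L ^ m * L ^ k) M) μ)) (by positivity) hmr'
  have hCn := hasMaj_bContr_if M (L ^ k) L k (fun ν x => (((L ^ k : ℕ) : ℝ)) • ((1 : Matrix ι ι ℝ) - T ν x)) (by positivity) hWr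
  have hCn' := hasMaj_bContr_if M (L ^ m * L ^ k) L k (fun ν x => (((L ^ m * L ^ k : ℕ) : ℝ)) • ((1 : Matrix ι ι ℝ) - T' ν x)) (by positivity) hWr'
  have hCt' := hasMaj_bContr_if M (L ^ m * L ^ k) L k (fun μ z => ((((L ^ m * L ^ k : ℕ) : ℝ)) • ((1 : Matrix ι ι ℝ) - T' μ (z - unitVec (fine (L ^ m * L ^ k) M) μ)))ᵀ) (by positivity) hNTr'
  -- the averaging words (as n15-c∕228) on both grids, block-diagonal
  have hQQa : HasMaj (BlockNorm.ofBlocks (unitTorusGeo L k M) (liftBlk (blockOf (L ^ k) M) ι)) (BlockNorm.ofBlocks (unitTorusGeo L k M) (liftBlk (blockOf (L ^ k) M) ι)) (Matrix.mulVecLin (a • (((csavg M (L ^ k) (fun (_ : Fin (d + 1)) (_ : Tor (fine (L ^ k) M)) => (1 : Matrix ι ι ℝ))))ᵀ * (csavg M (L ^ k) (fun (_ : Fin (d + 1)) (_ : Tor (fine (L ^ k) M)) => (1 : Matrix ι ι ℝ))) - ((csavg M (L ^ k) T))ᵀ * (csavg M (L ^ k) T)))) (fun y y' => if y = y' then |a|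 * (((((L ^ k : ℕ) : ℝ)) ^ (d + 1))⁻¹ * (σ * τ + σ)) else 0) := by
    have hQQt := hasMaj_csavg_sub_transpose M (L ^ k) L k T hσ0 hσc
    have hQQ := hasMaj_csavg_sub M (L ^ k) L k T hσ0 hσr
    have hQ := hasMaj_csavg M (L ^ k) L k T hτ0 hτr
    have hQ1t := hasMaj_csavg_transpose M (L ^ k) L k (fun (_ : Fin (d + 1)) (_ : Tor (fine (L ^ k) M)) => (1 : Matrix ι ι ℝ)) zero_le_one (stair_one_cols M (L ^ k))
    have h1 : HasMaj (BlockNorm.ofBlocks (unitTorusGeo L k M) (liftBlk (blockOf (L ^ k) M) ι)) (BlockNorm.ofBlocks (unitTorusGeo L k M) (liftBlk (blockOf (L ^ k) M) ι)) (Matrix.mulVecLin (((csavg M (L ^ k) T) - (csavg M (L ^ k) (fun (_ : Fin (d + 1)) (_ : Tor (fine (L ^ k) M)) => (1 : Matrix ι ι ℝ))))ᵀ * (csavg M (L ^ k) T))) (fun y y' => (if y = y' then ((((L ^ k : ℕ) : ℝ)) ^ (d + 1))⁻¹ * σ else 0) * ((BlockNorm.ofBlocks (unitTorusGeo L k M)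 (liftBlk (fun y : Tor M => y) ι)).κ * τ)) := by
      rw [Matrix.mulVecLin_mul]; exact hasMaj_comp_localRight hQQt hQ fun y y' => by positivity
    have h2 : HasMaj (BlockNorm.ofBlocks (unitTorusGeo L k M) (liftBlk (blockOf (L ^ k) M) ι)) (BlockNorm.ofBlocks (unitTorusGeo L k M) (liftBlk (blockOf (L ^ k) M) ι)) (Matrix.mulVecLin (((csavg M (L ^ k) (fun (_ : Fin (d + 1)) (_ : Tor (fine (L ^ k) M)) => (1 : Matrix ι ι ℝ))))ᵀ * ((csavg M (L ^ k) T) - (csavg M (L ^ k) (fun (_ : Fin (d + 1)) (_ : Tor (fine (L ^ k) M)) => (1 : Matrix ι ι ℝ)))))) (fun y y' => (if y = y' then ((((L ^ k : ℕ) : ℝ)) ^ (d + 1))⁻¹ * 1 else 0) * ((BlockNorm.ofBlocks (unitTorusGeo L k M) (liftBlk (fun y : Tor M => y) ι)).κ * σ)) := by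
      rw [Matrix.mulVecLin_mul]; exact hasMaj_comp_localRight hQ1t hQQ fun y y' => by positivity
    have hQ' : (((csavg M (L ^ k) (fun (_ : Fin (d + 1)) (_ : Tor (fine (L ^ k) M)) => (1 : Matrix ι ι ℝ))))ᵀ * (csavg M (L ^ k) (fun (_ : Fin (d + 1)) (_ : Tor (fine (L ^ k) M)) => (1 : Matrix ι ι ℝ))) - ((csavg M (L ^ k) T))ᵀ * (csavg M (L ^ k) T)) = -((((csavg M (L ^ k) T) - (csavg M (L ^ k) (fun (_ : Fin (d + 1)) (_ : Tor (fine (L ^ k) M)) => (1 : Matrix ι ι ℝ))))ᵀ * (csavg M (L ^ k) T)) + (((csavg M (L ^ k) (fun (_ : Fin (d + 1)) (_ : Tor (fine (L ^ k) M)) => (1 : Matrix ι ι ℝ))))ᵀ * ((csavg M (L ^ k) T) - (csavg M (L ^ k) (fun (_ : Fin (d + 1)) (_ : Tor (fine (L ^ k) M)) => (1 : Matrix ι ι ℝ)))))) := by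
      rw [Matrix.transpose_sub, Matrix.sub_mul, Matrix.mul_sub]; abel
    have h := hasMaj_smul_ofBlocks (g := unitTorusGeo L k M) (liftBlk (blockOf (L ^ k) M) ι) (K := fun y y' => if y = y' then ((((L ^ k : ℕ) : ℝ)) ^ (d + 1))⁻¹ * (σ * τ + σ) else 0) (fun y y' => by positivity) a
      (show HasMaj (BlockNorm.ofBlocks (unitTorusGeo L k M) (liftBlk (blockOf (L ^ k) M) ι)) (BlockNorm.ofBlocks (unitTorusGeo L k M) (liftBlk (blockOf (L ^ k) M) ι)) (Matrix.mulVecLin (((csavg M (L ^ k) (fun (_ : Fin (d + 1)) (_ : Tor (fine (L ^ k) M)) => (1 : Matrix ι ι ℝ))))ᵀ * (csavg M (L ^ k) (fun (_ : Fin (d + 1)) (_ : Tor (fine (L ^ k) M)) => (1 : Matrix ι ι ℝ))) - ((csavg M (L ^ k) T))ᵀ * (csavg M (L ^ k) T))) (fun y y' => if y = y' then ((((L ^ k : ℕ) : ℝ)) ^ (d + 1))⁻¹ * (σ * τ + σ) else 0) by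
        rw [hQ', mulVecLin_neg', Matrix.mulVecLin_add]
        refine ((h1.add h2).neg).mono fun y y' => le_of_eq ?_
        rw [hκU]; split_ifs <;> ring)
    rw [← mulVecLin_smul'] at h
    exact h.mono fun y y' => le_of_eq (by split_ifs <;> simp)
  have hQQa' : HasMaj (BlockNorm.ofBlocks (unitTorusGeo L k M) (liftBlk (blockOf (L ^ m * L ^ k) M) ι)) (BlockNorm.ofBlocks (unitTorusGeo L k M) (liftBlk (blockOf (L ^ m * L ^ k) M) ι)) (Matrix.mulVecLin (a' • (((csavg M (L ^ m * L ^ k) (fun (_ : Fin (d + 1)) (_ : Tor (fine (L ^ m * L ^ k) M)) => (1 : Matrix ι ι ℝ))))ᵀ * (csavg M (L ^ m * L ^ k) (fun (_ : Fin (d + 1)) (_ : Tor (fine (L ^ m * L ^ k) M)) => (1 : Matrix ι ι ℝ))) - ((csavg M (L ^ m * L ^ k) T'))ᵀ * (csavg M (L ^ m * L ^ k) T')))) (fun y y' => if y = y' then |a'| * (((((L ^ m * L ^ k : ℕ) : ℝ)) ^ (d + 1))⁻¹ * (σ₁ * τ₁ + σ₁)) else 0) := by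
    have hQQt := hasMaj_csavg_sub_transpose M (L ^ m * L ^ k) L k T' hσ₁0 hσc'
    have hQQ := hasMaj_csavg_sub M (L ^ m * L ^ k) L k T' hσ₁0 hσr'
    have hQ := hasMaj_csavg M (L ^ m * L ^ k) L k T' hτ₁0 hτr'
    have hQ1t := hasMaj_csavg_transpose M (L ^ m * L ^ k) L k (fun (_ : Fin (d + 1)) (_ : Tor (fine (L ^ m * L ^ k) M)) => (1 : Matrix ι ι ℝ)) zero_le_one (stair_one_cols M (L ^ m * L ^ k))
    have h1 : HasMaj (BlockNorm.ofBlocks (unitTorusGeo L k M) (liftBlk (blockOf (L ^ m * L ^ k) M) ι)) (BlockNorm.ofBlocks (unitTorusGeo L k M) (liftBlk (blockOf (L ^ m * L ^ k) M) ι)) (Matrix.mulVecLin (((csavg M (L ^ m * L ^ k) T') - (csavg M (L ^ m * L ^ k) (fun (_ : Fin (d + 1)) (_ : Tor (fine (L ^ m * L ^ k) M)) => (1 : Matrix ι ι ℝ))))ᵀ * (csavg M (L ^ m * L ^ k) T'))) (fun y y' => (if y = y' then ((((L ^ m * L ^ k : ℕ) : ℝ)) ^ (d + 1))⁻¹ *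 σ₁ else 0) * ((BlockNorm.ofBlocks (unitTorusGeo L k M) (liftBlk (fun y : Tor M => y) ι)).κ * τ₁)) := by
      rw [Matrix.mulVecLin_mul]; exact hasMaj_comp_localRight hQQt hQ fun y y' => by positivity
    have h2 : HasMaj (BlockNorm.ofBlocks (unitTorusGeo L k M) (liftBlk (blockOf (L ^ m * L ^ k) M) ι)) (BlockNorm.ofBlocks (unitTorusGeo L k M) (liftBlk (blockOf (L ^ m * L ^ k) M) ι)) (Matrix.mulVecLin (((csavg M (L ^ m * L ^ k) (fun (_ : Fin (d + 1)) (_ : Tor (fine (L ^ m * L ^ k) M)) => (1 : Matrix ι ι ℝ))))ᵀ * ((csavg M (L ^ m * L ^ k) T') - (csavg M (L ^ m * L ^ k) (fun (_ : Fin (d + 1)) (_ : Tor (fine (L ^ m * L ^ k) M)) => (1 : Matrix ι ι ℝ)))))) (fun y y' => (if y = y' then ((((L ^ m * L ^ k : ℕ) : ℝ)) ^ (d + 1))⁻¹ * 1 else 0) * ((BlockNorm.ofBlocks (unitTorusGeo L k M) (liftBlk (fun y : Tor M => y) ι)).κ * σ₁)) := by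
      rw [Matrix.mulVecLin_mul]; exact hasMaj_comp_localRight hQ1t hQQ fun y y' => by positivity
    have hQ' : (((csavg M (L ^ m * L ^ k) (fun (_ : Fin (d + 1)) (_ : Tor (fine (L ^ m * L ^ k) M)) => (1 : Matrix ι ι ℝ))))ᵀ * (csavg M (L ^ m * L ^ k) (fun (_ : Fin (d + 1)) (_ : Tor (fine (L ^ m * L ^ k) M)) => (1 : Matrix ι ι ℝ))) - ((csavg M (L ^ m * L ^ k) T'))ᵀ * (csavg M (L ^ m * L ^ k) T')) = -((((csavg M (L ^ m * L ^ k) T') - (csavg M (L ^ m * L ^ k) (fun (_ : Fin (d + 1)) (_ : Tor (fine (L ^ m * L ^ k) M)) => (1 : Matrix ι ι ℝ))))ᵀ * (csavg M (L ^ m * L ^ k) T')) + (((csavg M (L ^ m * L ^ k) (fun (_ : Fin (d + 1)) (_ : Tor (fine (L ^ m * L ^ k) M)) => (1 : Matrix ι ι ℝ))))ᵀ * ((csavg M (L ^ m * L ^ k) T') - (csavg M (L ^ m * L ^ k) (fun (_ : Fin (d + 1)) (_ : Tor (fine (L ^ m * L ^ k) M)) => (1 : Matrix ι ι ℝ))))))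 := by
      rw [Matrix.transpose_sub, Matrix.sub_mul, Matrix.mul_sub]; abel
    have h := hasMaj_smul_ofBlocks (g := unitTorusGeo L k M) (liftBlk (blockOf (L ^ m * L ^ k) M) ι) (K := fun y y' => if y = y' then ((((L ^ m * L ^ k : ℕ) : ℝ)) ^ (d + 1))⁻¹ * (σ₁ * τ₁ + σ₁) else 0) (fun y y' => by positivity) a'
      (show HasMaj (BlockNorm.ofBlocks (unitTorusGeo L k M) (liftBlk (blockOf (L ^ m * L ^ k) M) ι)) (BlockNorm.ofBlocks (unitTorusGeo L k M) (liftBlk (blockOf (L ^ m * L ^ k) M) ι)) (Matrix.mulVecLin (((csavg M (L ^ m * L ^ k) (fun (_ : Fin (d + 1)) (_ : Tor (fine (L ^ m * L ^ k) M)) => (1 : Matrix ι ι ℝ))))ᵀ * (csavg M (L ^ m * L ^ k) (fun (_ : Fin (d + 1)) (_ : Tor (fine (L ^ m * L ^ k) M)) => (1 : Matrix ι ι ℝ))) - ((csavg M (L ^ m * L ^ k) T'))ᵀ * (csavg M (L ^ m * L ^ k) T'))) (fun y y' => if y = y' then ((((L ^ m * L ^ k : ℕ) : ℝ)) ^ (d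 + 1))⁻¹ * (σ₁ * τ₁ + σ₁) else 0) by
        rw [hQ', mulVecLin_neg', Matrix.mulVecLin_add]
        refine ((h1.add h2).neg).mono fun y y' => le_of_eq ?_
        rw [hκU]; split_ifs <;> ring)
    rw [← mulVecLin_smul'] at h
    exact h.mono fun y y' => le_of_eq (by split_ifs <;> simp)
  -- the local word `𝔚 = 𝔰_{div N} − 𝔰_m + a𝒬` on both grids
  have hW : HasMaj (BlockNorm.ofBlocks (unitTorusGeo L k M) (liftBlk (blockOf (L ^ k) M) ι)) (BlockNorm.ofBlocks (unitTorusGeo L k M) (liftBlk (blockOf (L ^ k) M) ι)) (Matrix.mulVecLin (sDiag M (L ^ k) (bDiv M (L ^ k) (fun ν x => (((L ^ k : ℕ) : ℝ)) • ((1 : Matrix ι ι ℝ) - T ν x)))) - Matrix.mulVecLin (sDiag M (L ^ k) (fun z => ∑ μ, ((fun ν x => (((L ^ k : ℕ) : ℝ)) • ((1 : Matrix ι ι ℝ) - T ν x)) μ (z - unitVec (fine (L ^ k) M) μ))ᵀ * (fun ν x => (((L ^ k : ℕ) : ℝ)) • ((1 : Matrix ι ι ℝ) - T ν x)) μ (z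 - unitVec (fine (L ^ k) M) μ))) + Matrix.mulVecLin (a • (((csavg M (L ^ k) (fun (_ : Fin (d + 1)) (_ : Tor (fine (L ^ k) M)) => (1 : Matrix ι ι ℝ))))ᵀ * (csavg M (L ^ k) (fun (_ : Fin (d + 1)) (_ : Tor (fine (L ^ k) M)) => (1 : Matrix ι ι ℝ))) - ((csavg M (L ^ k) T))ᵀ * (csavg M (L ^ k) T)))) (fun y y' => if y = y' then (((d : ℝ) + 1) * (((L ^ k : ℕ) : ℝ)) * ((((L ^ k : ℕ) : ℝ)) * lam) + ((d : ℝ) + 1) * (((((L ^ k : ℕ) : ℝ)) * ρ) * ((((L ^ k : ℕ) : ℝ)) * ρ)) + |a| * (((((L ^ k : ℕ) : ℝ)) ^ (d + 1))⁻¹ * (σ * τ + σ))) else 0) :=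
    ((hSD.sub hMD).add hQQa).mono fun y y' => le_of_eq (by split_ifs <;> ring)
  have hW' : HasMaj (BlockNorm.ofBlocks (unitTorusGeo L k M) (liftBlk (blockOf (L ^ m * L ^ k) M) ι)) (BlockNorm.ofBlocks (unitTorusGeo L k M) (liftBlk (blockOf (L ^ m * L ^ k) M) ι)) (Matrix.mulVecLin (sDiag M (L ^ m * L ^ k) (bDiv M (L ^ m * L ^ k) (fun ν x => (((L ^ m * L ^ k : ℕ) : ℝ)) • ((1 : Matrix ι ι ℝ) - T' ν x)))) - Matrix.mulVecLin (sDiag M (L ^ m * L ^ k) (fun z => ∑ μ, ((fun ν x => (((L ^ m * L ^ k : ℕ) : ℝ)) • ((1 : Matrix ι ι ℝ) - T' ν x)) μ (z - unitVec (fine (L ^ m * L ^ k) M) μ))ᵀ * (fun ν x => (((L ^ m * L ^ k : ℕ) : ℝ)) • ((1 : Matrix ι ι ℝ) - T' ν x)) μ (z - unitVec (fine (L ^ m * L ^ k) M) μ))) + Matrix.mulVecLin (a' • (((csavg M (L ^ m * L ^ k) (fun (_ : Fin (d + 1)) (_ : Tor (fine (L ^ m * L ^ k) M)) => (1 : Matrix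 ι ι ℝ))))ᵀ * (csavg M (L ^ m * L ^ k) (fun (_ : Fin (d + 1)) (_ : Tor (fine (L ^ m * L ^ k) M)) => (1 : Matrix ι ι ℝ))) - ((csavg M (L ^ m * L ^ k) T'))ᵀ * (csavg M (L ^ m * L ^ k) T')))) (fun y y' => if y = y' then (((d : ℝ) + 1) * (((L ^ m * L ^ k : ℕ) : ℝ)) * ((((L ^ m * L ^ k : ℕ) : ℝ)) * lam₁) + ((d : ℝ) + 1) * (((((L ^ m * L ^ k : ℕ) : ℝ)) * ρ₁) * ((((L ^ m * L ^ k : ℕ) : ℝ)) * ρ₁)) + |a'| * (((((L ^ m * L ^ k : ℕ) : ℝ)) ^ (d + 1))⁻¹ * (σ₁ * τ₁ + σ₁))) else 0) :=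
    ((hSD'.sub hMD').add hQQa').mono fun y y' => le_of_eq (by split_ifs <;> ring)
  -- ### coarse one-grid rows: `𝔚G′(T)`, `Bᵀ`, `Z`
  have hWG : HasMaj (BlockNorm.ofBlocks (unitTorusGeo L k M) (liftBlk (blockOf (L ^ k) M) ι)) (BlockNorm.ofBlocks (unitTorusGeo L k M) (liftBlk (blockOf (L ^ k) M) ι)) ((Matrix.mulVecLin (sDiag M (L ^ k) (bDiv M (L ^ k) (fun ν x => (((L ^ k : ℕ) : ℝ)) • ((1 : Matrix ι ι ℝ) - T ν x)))) - Matrix.mulVecLin (sDiag M (L ^ k) (fun z => ∑ μ, ((fun ν x => (((L ^ k : ℕ) : ℝ)) • ((1 : Matrix ι ι ℝ) - T ν x)) μ (z - unitVec (fine (L ^ k) M) μ))ᵀ * (fun ν x => (((L ^ k : ℕ) : ℝ)) • ((1 : Matrix ι ι ℝ) - T ν x)) μ (z - unitVec (fine (L ^ k) M) μ))) + Matrix.mulVecLin (a • (((csavg M (L ^ k) (fun (_ : Fin (d + 1)) (_ : Tor (fine (L ^ k) M)) => (1 : Matrix ι ι ℝ))))ᵀ * (csavg M (L ^ k) (fun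 (_ : Fin (d + 1)) (_ : Tor (fine (L ^ k) M)) => (1 : Matrix ι ι ℝ))) - ((csavg M (L ^ k) T))ᵀ * (csavg M (L ^ k) T)))) ∘ₗ Matrix.mulVecLin (cGreen M (L ^ k) T a)) (fun y y' => ((((d : ℝ) + 1) * (((L ^ k : ℕ) : ℝ)) * ((((L ^ k : ℕ) : ℝ)) * lam) + ((d : ℝ) + 1) * (((((L ^ k : ℕ) : ℝ)) * ρ) * ((((L ^ k : ℕ) : ℝ)) * ρ)) + |a| * (((((L ^ k : ℕ) : ℝ)) ^ (d + 1))⁻¹ * (σ * τ + σ))) * CX) * Real.exp (-(δ * tdistT M y y'))) :=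
    (hasMaj_comp_localLeft (by positivity) hW hX).mono fun y y' => le_of_eq (by rw [hκS]; ring)
  have hBts : HasMaj (BlockNorm.ofBlocks (unitTorusGeo L k M) (liftBlk (fun b : Tor (fine (L ^ k) M) × Fin (d + 1) => blockOf (L ^ k) M b.1) ι)) (BlockNorm.ofBlocks (unitTorusGeo L k M) (liftBlk (blockOf (L ^ k) M) ι)) (Matrix.mulVecLin (((cgrad M (L ^ k) (fun (_ : Fin (d + 1)) (_ : Tor (fine (L ^ k) M)) => (1 : Matrix ι ι ℝ))) - cgrad M (L ^ k) T))ᵀ) (fun y y' => (((L ^ k : ℕ) : ℝ)) * ((d + 1 : ℕ) * ρ) * Real.exp (δ + s) * Real.exp (-((δ + s) * tdistT M y y'))) := by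
    rw [show ((cgrad M (L ^ k) (fun (_ : Fin (d + 1)) (_ : Tor (fine (L ^ k) M)) => (1 : Matrix ι ι ℝ))) - cgrad M (L ^ k) T) = -(cgrad M (L ^ k) T - (cgrad M (L ^ k) (fun (_ : Fin (d + 1)) (_ : Tor (fine (L ^ k) M)) => (1 : Matrix ι ι ℝ)))) from (neg_sub _ _).symm, Matrix.transpose_neg, mulVecLin_neg']
    exact (hasMaj_cgrad_sub_transpose M (L ^ k) L k T hρ0 (by linarith : 0 ≤ δ + s) hρc).neg
  have hZrow : HasMaj (BlockNorm.ofBlocks (unitTorusGeo L k M) (liftBlk (blockOf (L ^ k) M) ι)) (BlockNorm.ofBlocks (unitTorusGeo L k M) (liftBlk (blockOf (L ^ k) M) ι)) ((Matrix.mulVecLin (((cgrad M (L ^ k) (fun (_ : Fin (d + 1)) (_ : Tor (fine (L ^ k) M)) => (1 : Matrix ι ι ℝ))) - cgrad M (L ^ k) T))ᵀ - Matrix.mulVecLin (bContr M (L ^ k) (fun ν x => (((L ^ k : ℕ) : ℝ)) • ((1 : Matrix ι ι ℝ) - T ν x)))) ∘ₗ Matrix.mulVecLin ((cgrad M (L ^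 k) (fun (_ : Fin (d + 1)) (_ : Tor (fine (L ^ k) M)) => (1 : Matrix ι ι ℝ))) * (cGreen M (L ^ k) T a))) (fun y y' => (((((L ^ k : ℕ) : ℝ)) * ((d + 1 : ℕ) * ρ) * Real.exp (δ + s)) * CY * c + (((d : ℝ) + 1) * ((((L ^ k : ℕ) : ℝ)) * ρ)) * CY) * Real.exp (-(δ * tdistT M y y'))) := by
    rw [LinearMap.sub_comp]
    exact ((hasMaj_comp_exp (ρ := δ) htri hd hrow (by positivity) hCY hδ le_rfl (by linarith) hBts hY).sub (hasMaj_comp_localLeft (by positivity) hCn hY)).mono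
      fun y y' => le_of_eq (by rw [hκV]; ring)
  -- the fine step `K′_Z = ℭ_Ñ′[S̄ₕ′∂′G′(1)′] − ℭ_N′[∂′G′(1)′]`
  have hKZ' : HasMaj (BlockNorm.ofBlocks (unitTorusGeo L k M) (liftBlk (blockOf (L ^ m * L ^ k) M) ι)) (BlockNorm.ofBlocks (unitTorusGeo L k M) (liftBlk (blockOf (L ^ m * L ^ k) M) ι)) (Matrix.mulVecLin (bContr M (L ^ m * L ^ k) (fun μ z => ((((L ^ m * L ^ k : ℕ) : ℝ)) • ((1 : Matrix ι ι ℝ) - T' μ (z - unitVec (fine (L ^ m * L ^ k) M) μ)))ᵀ)) ∘ₗ Matrix.mulVecLin ((bBack M (L ^ m * L ^ k) (ι := ι)) * ((cgrad M (L ^ m * L ^ k) (fun (_ : Fin (d + 1)) (_ : Tor (fine (L ^ m * L ^ k) M)) => (1 : Matrix ι ι ℝ))) * (cGreen M (L ^ m * L ^ k) (fun (_ : Fin (d + 1)) (_ : Tor (fine (L ^ m * L ^ k) M)) => (1 : Matrix ι ι ℝ)) a'))) - Matrix.mulVecLin (bContr M (L ^ m * L ^ k) (fun ν x => (((L ^ m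 * L ^ k : ℕ) : ℝ)) • ((1 : Matrix ι ι ℝ) - T' ν x))) ∘ₗ Matrix.mulVecLin ((cgrad M (L ^ m * L ^ k) (fun (_ : Fin (d + 1)) (_ : Tor (fine (L ^ m * L ^ k) M)) => (1 : Matrix ι ι ℝ))) * (cGreen M (L ^ m * L ^ k) (fun (_ : Fin (d + 1)) (_ : Tor (fine (L ^ m * L ^ k) M)) => (1 : Matrix ι ι ℝ)) a'))) (fun y y' => (((d : ℝ) + 1) * ((((L ^ m * L ^ k : ℕ) : ℝ)) * ρ₁) * (CDb₁ + CD₁)) * Real.exp (-(δ * tdistT M y y'))) :=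
    ((hasMaj_comp_localLeft (by positivity) hCt' hD1b').sub (hasMaj_comp_localLeft (by positivity) hCn' hD1')).mono fun y y' => le_of_eq (by rw [hκV1]; ring)
  -- ### two-grid pieces
  -- `𝔇(𝔚′G′(T′), 𝔚G′(T)) = 𝔚′·𝔇(G′) + (oscillations)·G′(T)`
  have hDW : HasMaj (BlockNorm.ofBlocks (unitTorusGeo L k M) (liftBlk (blockOf (L ^ k) M) ι)) (BlockNorm.ofBlocks (unitTorusGeo L k M) (liftBlk (blockOf (L ^ m * L ^ k) M) ι)) (idef (pull (liftMap (kingPr L k m M) ι)) (pull (liftMap (kingPr L k m M) ι)) ((Matrix.mulVecLin (sDiag M (L ^ m * L ^ k) (bDiv M (L ^ m * L ^ k) (fun ν x => (((L ^ m * L ^ k : ℕ) : ℝ)) • ((1 : Matrix ι ι ℝ) - T' ν x)))) - Matrix.mulVecLin (sDiag M (L ^ m * L ^ k) (fun z => ∑ μ, ((fun ν x => (((L ^ m * L ^ k : ℕ) : ℝ)) • ((1 : Matrix ι ι ℝ) - T' ν x)) μ (z - unitVec (fine (L ^ m * L ^ k) M) μ))ᵀ * (fun ν x => (((L ^ m *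 L ^ k : ℕ) : ℝ)) • ((1 : Matrix ι ι ℝ) - T' ν x)) μ (z - unitVec (fine (L ^ m * L ^ k) M) μ))) + Matrix.mulVecLin (a' • (((csavg M (L ^ m * L ^ k) (fun (_ : Fin (d + 1)) (_ : Tor (fine (L ^ m * L ^ k) M)) => (1 : Matrix ι ι ℝ))))ᵀ * (csavg M (L ^ m * L ^ k) (fun (_ : Fin (d + 1)) (_ : Tor (fine (L ^ m * L ^ k) M)) => (1 : Matrix ι ι ℝ))) - ((csavg M (L ^ m * L ^ k) T'))ᵀ * (csavg M (L ^ m * L ^ k) T')))) ∘ₗ Matrix.mulVecLin (cGreen M (L ^ m * L ^ k) T' a')) ((Matrix.mulVecLin (sDiag M (L ^ k) (bDiv M (L ^ k) (fun ν x => (((L ^ k : ℕ) : ℝ)) • ((1 : Matrix ι ι ℝ) - T ν x)))) - Matrix.mulVecLin (sDiag M (L ^ k) (fun z => ∑ μ, ((fun ν x => (((L ^ k : ℕ) : ℝ)) • ((1 : Matrix ι ι ℝ) - T ν x)) μ (z - unitVec (fine (L ^ k) M) μ))ᵀ * (fun ν x => (((L ^ k : ℕ) : ℝ)) • ((1 :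 Matrix ι ι ℝ) - T ν x)) μ (z - unitVec (fine (L ^ k) M) μ))) + Matrix.mulVecLin (a • (((csavg M (L ^ k) (fun (_ : Fin (d + 1)) (_ : Tor (fine (L ^ k) M)) => (1 : Matrix ι ι ℝ))))ᵀ * (csavg M (L ^ k) (fun (_ : Fin (d + 1)) (_ : Tor (fine (L ^ k) M)) => (1 : Matrix ι ι ℝ))) - ((csavg M (L ^ k) T))ᵀ * (csavg M (L ^ k) T)))) ∘ₗ Matrix.mulVecLin (cGreen M (L ^ k) T a))) (fun y y' => ((((d : ℝ) + 1) * (((L ^ m * L ^ k : ℕ) : ℝ)) * ((((L ^ m * L ^ k : ℕ) : ℝ)) * lam₁) + ((d : ℝ) + 1) * (((((L ^ m * L ^ k : ℕ) : ℝ)) * ρ₁) * ((((L ^ m * L ^ k : ℕ) : ℝ)) * ρ₁)) + |a'| * (((((L ^ m * L ^ k : ℕ) : ℝ)) ^ (d + 1))⁻¹ * (σ₁ * τ₁ + σ₁))) * εX + (ωV + ωm + φQ) * CX) * Real.exp (-(δ * tdistT M y y'))) := by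
    rw [idef_comp (pull (liftMap (kingPr L k m M) ι)) (pull (liftMap (kingPr L k m M) ι)) (pull (liftMap (kingPr L k m M) ι)) (Matrix.mulVecLin (sDiag M (L ^ m * L ^ k) (bDiv M (L ^ m * L ^ k) (fun ν x => (((L ^ m * L ^ k : ℕ) : ℝ)) • ((1 : Matrix ι ι ℝ) - T' ν x)))) - Matrix.mulVecLin (sDiag M (L ^ m * L ^ k) (fun z => ∑ μ, ((fun ν x => (((L ^ m * L ^ k : ℕ) : ℝ)) • ((1 : Matrix ι ι ℝ) - T' ν x)) μ (z - unitVec (fine (L ^ m * L ^ k) M) μ))ᵀ * (fun ν x => (((L ^ m * L ^ k : ℕ) : ℝ)) • ((1 : Matrix ι ι ℝ) - T' ν x)) μ (z - unitVec (fine (L ^ m * L ^ k) M) μ))) + Matrix.mulVecLin (a' • (((csavg M (L ^ m * L ^ k) (fun (_ : Fin (d + 1)) (_ : Tor (fine (L ^ m * L ^ k) M)) => (1 : Matrix ι ι ℝ))))ᵀ * (csavg M (L ^ m * L ^ k) (fun (_ : Fin (d + 1)) (_ : Tor (fine (L ^ m * L ^ k) M)) => (1 : Matrix ι ι ℝ)))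 - ((csavg M (L ^ m * L ^ k) T'))ᵀ * (csavg M (L ^ m * L ^ k) T')))) (Matrix.mulVecLin (cGreen M (L ^ m * L ^ k) T' a')) (Matrix.mulVecLin (sDiag M (L ^ k) (bDiv M (L ^ k) (fun ν x => (((L ^ k : ℕ) : ℝ)) • ((1 : Matrix ι ι ℝ) - T ν x)))) - Matrix.mulVecLin (sDiag M (L ^ k) (fun z => ∑ μ, ((fun ν x => (((L ^ k : ℕ) : ℝ)) • ((1 : Matrix ι ι ℝ) - T ν x)) μ (z - unitVec (fine (L ^ k) M) μ))ᵀ * (fun ν x => (((L ^ k : ℕ) : ℝ)) • ((1 : Matrix ι ι ℝ) - T ν x)) μ (z - unitVec (fine (L ^ k) M) μ))) + Matrix.mulVecLin (a • (((csavg M (L ^ k) (fun (_ : Fin (d + 1)) (_ : Tor (fine (L ^ k) M)) => (1 : Matrix ι ι ℝ))))ᵀ * (csavg M (L ^ k) (fun (_ : Fin (d + 1)) (_ : Tor (fine (L ^ k) M)) => (1 : Matrix ι ι ℝ))) - ((csavg M (L ^ k) T))ᵀ * (csavg M (L ^ k) T)))) (Matrix.mulVecLin (cGreen M (L ^ k)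 T a)), idef_add, idef_sub, LinearMap.add_comp, LinearMap.sub_comp, idef_sDiag, idef_sDiag]
    refine ((hasMaj_comp_localLeft (by positivity) hW' hXG).add
      (((hasMaj_comp_localLeft hωV0 (hasMaj_sDiag_pull M L k m _ hωV0 hωV) hX).sub (hasMaj_comp_localLeft hωm0 (hasMaj_sDiag_pull M L k m _ hωm0 hωm) hX)).add
        (hasMaj_comp_localLeft hφQ0 hDQ hX))).mono fun y y' => le_of_eq ?_
    rw [hκS1, hκS]; ring
  -- `𝔇(K′_Z, K_Z)`: flat kernel defects and oscillations of `Ñ`, `N`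
  have hDKZ : HasMaj (BlockNorm.ofBlocks (unitTorusGeo L k M) (liftBlk (blockOf (L ^ k) M) ι)) (BlockNorm.ofBlocks (unitTorusGeo L k M) (liftBlk (blockOf (L ^ m * L ^ k) M) ι)) (idef (pull (liftMap (kingPr L k m M) ι)) (pull (liftMap (kingPr L k m M) ι)) (Matrix.mulVecLin (bContr M (L ^ m * L ^ k) (fun μ z => ((((L ^ m * L ^ k : ℕ) : ℝ)) • ((1 : Matrix ι ι ℝ) - T' μ (z - unitVec (fine (L ^ m * L ^ k) M) μ)))ᵀ)) ∘ₗ Matrix.mulVecLin ((bBack M (L ^ m * L ^ k) (ι := ι)) * ((cgrad M (L ^ m * L ^ k) (fun (_ : Fin (d + 1)) (_ : Tor (fine (L ^ m * L ^ k) M)) => (1 : Matrix ι ι ℝ))) * (cGreen M (L ^ m * L ^ k) (fun (_ : Fin (d + 1)) (_ : Tor (fine (L ^ m * L ^ k) M)) => (1 : Matrix ι ι ℝ)) a'))) - Matrix.mulVecLin (bContr M (L ^ m * L ^ k) (fun ν x => (((L ^ m * L ^ k : ℕ) : ℝ)) • ((1 : Matrix ι ι ℝ) - T' ν x))) ∘ₗ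 Matrix.mulVecLin ((cgrad M (L ^ m * L ^ k) (fun (_ : Fin (d + 1)) (_ : Tor (fine (L ^ m * L ^ k) M)) => (1 : Matrix ι ι ℝ))) * (cGreen M (L ^ m * L ^ k) (fun (_ : Fin (d + 1)) (_ : Tor (fine (L ^ m * L ^ k) M)) => (1 : Matrix ι ι ℝ)) a'))) (Matrix.mulVecLin (bContr M (L ^ k) (fun μ z => ((((L ^ k : ℕ) : ℝ)) • ((1 : Matrix ι ι ℝ) - T μ (z - unitVec (fine (L ^ k) M) μ)))ᵀ)) ∘ₗ Matrix.mulVecLin ((bBack M (L ^ k) (ι := ι)) * ((cgrad M (L ^ k) (fun (_ : Fin (d + 1)) (_ : Tor (fine (L ^ k) M)) => (1 : Matrix ι ι ℝ))) * (cGreen M (L ^ k) (fun (_ : Fin (d + 1)) (_ : Tor (fine (L ^ k) M)) => (1 : Matrix ι ι ℝ)) a))) - Matrix.mulVecLin (bContr M (L ^ k) (fun ν x => (((L ^ k : ℕ) : ℝ)) • ((1 : Matrix ι ι ℝ) - T ν x))) ∘ₗ Matrix.mulVecLin ((cgrad M (L ^ k) (fun (_ : Fin (d + 1)) (_ : Tor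 (fine (L ^ k) M)) => (1 : Matrix ι ι ℝ))) * (cGreen M (L ^ k) (fun (_ : Fin (d + 1)) (_ : Tor (fine (L ^ k) M)) => (1 : Matrix ι ι ℝ)) a)))) (fun y y' => (((d : ℝ) + 1) * ((((L ^ m * L ^ k : ℕ) : ℝ)) * ρ₁) * εDb + ((d : ℝ) + 1) * ωN * CDb + ((d : ℝ) + 1) * ((((L ^ m * L ^ k : ℕ) : ℝ)) * ρ₁) * εD + ((d : ℝ) + 1) * ωN * CD) * Real.exp (-(δ * tdistT M y y'))) := by
    rw [idef_sub, idef_comp (pull (liftMap (kingPr L k m M) ι)) (pull (liftMap (kingPrV L k m M) ι)) (pull (liftMap (kingPr L k m M) ι)) (Matrix.mulVecLin (bContr M (L ^ m * L ^ k) (fun μ z => ((((L ^ m * L ^ k : ℕ) : ℝ)) • ((1 : Matrix ι ι ℝ) - T' μ (z - unitVec (fine (L ^ m * L ^ k) M) μ)))ᵀ))) (Matrix.mulVecLin ((bBack M (L ^ m * L ^ k) (ι := ι)) * ((cgrad M (L ^ m * L ^ k) (fun (_ : Fin (d + 1)) (_ : Tor (fine (L ^ m * L ^ k) M)) => (1 :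 Matrix ι ι ℝ))) * (cGreen M (L ^ m * L ^ k) (fun (_ : Fin (d + 1)) (_ : Tor (fine (L ^ m * L ^ k) M)) => (1 : Matrix ι ι ℝ)) a')))) (Matrix.mulVecLin (bContr M (L ^ k) (fun μ z => ((((L ^ k : ℕ) : ℝ)) • ((1 : Matrix ι ι ℝ) - T μ (z - unitVec (fine (L ^ k) M) μ)))ᵀ))) (Matrix.mulVecLin ((bBack M (L ^ k) (ι := ι)) * ((cgrad M (L ^ k) (fun (_ : Fin (d + 1)) (_ : Tor (fine (L ^ k) M)) => (1 : Matrix ι ι ℝ))) * (cGreen M (L ^ k) (fun (_ : Fin (d + 1)) (_ : Tor (fine (L ^ k) M)) => (1 : Matrix ι ι ℝ)) a)))),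
      idef_comp (pull (liftMap (kingPr L k m M) ι)) (pull (liftMap (kingPrV L k m M) ι)) (pull (liftMap (kingPr L k m M) ι)) (Matrix.mulVecLin (bContr M (L ^ m * L ^ k) (fun ν x => (((L ^ m * L ^ k : ℕ) : ℝ)) • ((1 : Matrix ι ι ℝ) - T' ν x)))) (Matrix.mulVecLin ((cgrad M (L ^ m * L ^ k) (fun (_ : Fin (d + 1)) (_ : Tor (fine (L ^ m * L ^ k) M)) => (1 : Matrix ι ι ℝ))) * (cGreen M (L ^ m * L ^ k) (fun (_ : Fin (d + 1)) (_ : Tor (fine (L ^ m * L ^ k) M)) => (1 : Matrix ι ι ℝ)) a'))) (Matrix.mulVecLin (bContr M (L ^ k) (fun ν x => (((L ^ k : ℕ) : ℝ)) • ((1 : Matrix ι ι ℝ) - T ν x)))) (Matrix.mulVecLin ((cgrad M (L ^ k) (fun (_ : Fin (d + 1)) (_ : Tor (fine (L ^ k) M)) => (1 : Matrix ι ι ℝ))) * (cGreen M (L ^ k) (fun (_ : Fin (d + 1)) (_ : Tor (fine (L ^ k) M)) => (1 : Matrix ι ι ℝ)) a))), idef_bContr, idef_bContr]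
    refine (((hasMaj_comp_localLeft (by positivity) hCt' hDDb).add (hasMaj_comp_localLeft (by positivity) (hasMaj_bContr_pull M L k m _ hωN0 hωNt) hD1b)).sub
      ((hasMaj_comp_localLeft (by positivity) hCn' hDD).add (hasMaj_comp_localLeft (by positivity) (hasMaj_bContr_pull M L k m _ hωN0 hωNr) hD1))).mono fun y y' => le_of_eq ?_
    rw [hκV1, hκV]; ring
  -- ### exact algebra: `∂G′(T) = S₂ + ∂G′(1)·Z`, `K_Z = (Bᵀ − ℭ_N)∂G′(1)`, `Z = S_Z + K_Z·Z` on both grids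
  have hBB : (((cgrad M (L ^ k) (fun (_ : Fin (d + 1)) (_ : Tor (fine (L ^ k) M)) => (1 : Matrix ι ι ℝ))) - cgrad M (L ^ k) T))ᵀ * ((cgrad M (L ^ k) (fun (_ : Fin (d + 1)) (_ : Tor (fine (L ^ k) M)) => (1 : Matrix ι ι ℝ))) - cgrad M (L ^ k) T) = sDiag M (L ^ k) (fun z => ∑ μ, ((fun ν x => (((L ^ k : ℕ) : ℝ)) • ((1 : Matrix ι ι ℝ) - T ν x)) μ (z - unitVec (fine (L ^ k) M) μ))ᵀ * (fun ν x => (((L ^ k : ℕ) : ℝ)) • ((1 : Matrix ι ι ℝ) - T ν x)) μ (z - unitVec (fine (L ^ k) M) μ)) := by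
    rw [cgrad_one_sub_eq_bMulShift]; exact bMulShift_transpose_mul_bMulShift M (L ^ k) (fun ν x => (((L ^ k : ℕ) : ℝ)) • ((1 : Matrix ι ι ℝ) - T ν x))
  have hBB' : (((cgrad M (L ^ m * L ^ k) (fun (_ : Fin (d + 1)) (_ : Tor (fine (L ^ m * L ^ k) M)) => (1 : Matrix ι ι ℝ))) - cgrad M (L ^ m * L ^ k) T'))ᵀ * ((cgrad M (L ^ m * L ^ k) (fun (_ : Fin (d + 1)) (_ : Tor (fine (L ^ m * L ^ k) M)) => (1 : Matrix ι ι ℝ))) - cgrad M (L ^ m * L ^ k) T') = sDiag M (L ^ m * L ^ k) (fun z => ∑ μ, ((fun ν x => (((L ^ m * L ^ k : ℕ) : ℝ)) • ((1 : Matrix ι ι ℝ) - T' ν x)) μ (z - unitVec (fine (L ^ m * L ^ k) M) μ))ᵀ * (fun ν x => (((L ^ m * L ^ k : ℕ) : ℝ)) • ((1 : Matrix ι ι ℝ) - T' ν x)) μ (z - unitVec (fine (L ^ m * L ^ k) M) μ)) := by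
    rw [cgrad_one_sub_eq_bMulShift]; exact bMulShift_transpose_mul_bMulShift M (L ^ m * L ^ k) (fun ν x => (((L ^ m * L ^ k : ℕ) : ℝ)) • ((1 : Matrix ι ι ℝ) - T' ν x))
  have hA1 : Matrix.mulVecLin ((cgrad M (L ^ k) (fun (_ : Fin (d + 1)) (_ : Tor (fine (L ^ k) M)) => (1 : Matrix ι ι ℝ))) * (cGreen M (L ^ k) T a)) = (Matrix.mulVecLin ((cgrad M (L ^ k) (fun (_ : Fin (d + 1)) (_ : Tor (fine (L ^ k) M)) => (1 : Matrix ι ι ℝ))) * (cGreen M (L ^ k) (fun (_ : Fin (d + 1)) (_ : Tor (fine (L ^ k) M)) => (1 : Matrix ι ι ℝ)) a)) + Matrix.mulVecLin ((cgrad M (L ^ k) (fun (_ : Fin (d + 1)) (_ : Tor (fine (L ^ k) M)) => (1 : Matrix ι ι ℝ))) * (cGreen M (L ^ k) (fun (_ : Fin (d + 1)) (_ : Tor (fine (L ^ k) M)) => (1 : Matrix ι ι ℝ)) a)) ∘ₗ ((Matrix.mulVecLin (sDiag M (L ^ k) (bDiv M (L ^ k) (fun ν x => (((L ^ k : ℕ)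 : ℝ)) • ((1 : Matrix ι ι ℝ) - T ν x)))) - Matrix.mulVecLin (sDiag M (L ^ k) (fun z => ∑ μ, ((fun ν x => (((L ^ k : ℕ) : ℝ)) • ((1 : Matrix ι ι ℝ) - T ν x)) μ (z - unitVec (fine (L ^ k) M) μ))ᵀ * (fun ν x => (((L ^ k : ℕ) : ℝ)) • ((1 : Matrix ι ι ℝ) - T ν x)) μ (z - unitVec (fine (L ^ k) M) μ))) + Matrix.mulVecLin (a • (((csavg M (L ^ k) (fun (_ : Fin (d + 1)) (_ : Tor (fine (L ^ k) M)) => (1 : Matrix ι ι ℝ))))ᵀ * (csavg M (L ^ k) (fun (_ : Fin (d + 1)) (_ : Tor (fine (L ^ k) M)) => (1 : Matrix ι ι ℝ))) - ((csavg M (L ^ k) T))ᵀ * (csavg M (L ^ k) T)))) ∘ₗ Matrix.mulVecLin (cGreen M (L ^ k) T a))) + Matrix.mulVecLin ((cgrad M (L ^ k) (fun (_ : Fin (d + 1)) (_ : Tor (fine (L ^ k) M)) => (1 : Matrix ι ι ℝ))) * (cGreen M (L ^ k) (fun (_ : Fin (d + 1)) (_ : Tor (fine (L ^ k) M)) =>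 (1 : Matrix ι ι ℝ)) a)) ∘ₗ ((Matrix.mulVecLin (((cgrad M (L ^ k) (fun (_ : Fin (d + 1)) (_ : Tor (fine (L ^ k) M)) => (1 : Matrix ι ι ℝ))) - cgrad M (L ^ k) T))ᵀ - Matrix.mulVecLin (bContr M (L ^ k) (fun ν x => (((L ^ k : ℕ) : ℝ)) • ((1 : Matrix ι ι ℝ) - T ν x)))) ∘ₗ Matrix.mulVecLin ((cgrad M (L ^ k) (fun (_ : Fin (d + 1)) (_ : Tor (fine (L ^ k) M)) => (1 : Matrix ι ι ℝ))) * (cGreen M (L ^ k) T a))) := by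
    have hL := cgrad_one_transpose_comp_B M (L ^ k) T
    have hM : ((cgrad M (L ^ k) (fun (_ : Fin (d + 1)) (_ : Tor (fine (L ^ k) M)) => (1 : Matrix ι ι ℝ))) * (cGreen M (L ^ k) T a)) = ((cgrad M (L ^ k) (fun (_ : Fin (d + 1)) (_ : Tor (fine (L ^ k) M)) => (1 : Matrix ι ι ℝ))) * (cGreen M (L ^ k) (fun (_ : Fin (d + 1)) (_ : Tor (fine (L ^ k) M)) => (1 : Matrix ι ι ℝ)) a)) + ((cgrad M (L ^ k) (fun (_ : Fin (d + 1)) (_ : Tor (fine (L ^ k) M)) => (1 : Matrix ι ι ℝ))) * (cGreen M (L ^ k) (fun (_ : Fin (d + 1)) (_ : Tor (fine (L ^ k) M)) => (1 : Matrix ι ι ℝ)) a)) * ((claplA M (L ^ k) (fun (_ : Fin (d + 1)) (_ : Tor (fine (L ^ k) M)) => (1 : Matrix ι ι ℝ)) a - claplA M (L ^ k) T a) * (cGreen M (L ^ k) T a)) := by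
      conv_lhs => rw [cGreen_eq_one_add_step_mul M (L ^ k) hT ha]
      simp only [Matrix.mul_add, Matrix.mul_assoc]
    set DG1m := ((cgrad M (L ^ k) (fun (_ : Fin (d + 1)) (_ : Tor (fine (L ^ k) M)) => (1 : Matrix ι ι ℝ))) * (cGreen M (L ^ k) (fun (_ : Fin (d + 1)) (_ : Tor (fine (L ^ k) M)) => (1 : Matrix ι ι ℝ)) a)) with hDG1m
    set Bm := ((cgrad M (L ^ k) (fun (_ : Fin (d + 1)) (_ : Tor (fine (L ^ k) M)) => (1 : Matrix ι ι ℝ))) - cgrad M (L ^ k) T) with hBm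
    conv_lhs => rw [hM, claplA_one_sub_claplA, ← hBm, hBB]
    simp only [Matrix.mulVecLin_add, mulVecLin_sub', Matrix.mulVecLin_mul]
    rw [hL]
    simp only [LinearMap.comp_add, LinearMap.comp_sub, LinearMap.add_comp, LinearMap.sub_comp, LinearMap.comp_assoc]
    abel
  have hA1' : Matrix.mulVecLin ((cgrad M (L ^ m * L ^ k) (fun (_ : Fin (d + 1)) (_ : Tor (fine (L ^ m * L ^ k) M)) => (1 : Matrix ι ι ℝ))) * (cGreen M (L ^ m * L ^ k) T' a')) = (Matrix.mulVecLin ((cgrad M (L ^ m * L ^ k) (fun (_ : Fin (d + 1)) (_ : Tor (fine (L ^ m * L ^ k) M)) => (1 : Matrix ι ι ℝ))) * (cGreen M (L ^ m * L ^ k) (fun (_ : Fin (d + 1)) (_ : Tor (fine (L ^ m * L ^ k) M)) => (1 : Matrix ι ι ℝ)) a')) + Matrix.mulVecLin ((cgrad M (L ^ m * L ^ k) (fun (_ : Fin (d + 1)) (_ : Tor (fine (L ^ m * L ^ k) M)) => (1 : Matrix ι ι ℝ))) * (cGreen M (L ^ m * L ^ k) (fun (_ : Fin (d + 1)) (_ :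 Tor (fine (L ^ m * L ^ k) M)) => (1 : Matrix ι ι ℝ)) a')) ∘ₗ ((Matrix.mulVecLin (sDiag M (L ^ m * L ^ k) (bDiv M (L ^ m * L ^ k) (fun ν x => (((L ^ m * L ^ k : ℕ) : ℝ)) • ((1 : Matrix ι ι ℝ) - T' ν x)))) - Matrix.mulVecLin (sDiag M (L ^ m * L ^ k) (fun z => ∑ μ, ((fun ν x => (((L ^ m * L ^ k : ℕ) : ℝ)) • ((1 : Matrix ι ι ℝ) - T' ν x)) μ (z - unitVec (fine (L ^ m * L ^ k) M) μ))ᵀ * (fun ν x => (((L ^ m * L ^ k : ℕ) : ℝ)) • ((1 : Matrix ι ι ℝ) - T' ν x)) μ (z - unitVec (fine (L ^ m * L ^ k) M) μ))) + Matrix.mulVecLin (a' • (((csavg M (L ^ m * L ^ k) (fun (_ : Fin (d + 1)) (_ : Tor (fine (L ^ m * L ^ k) M)) => (1 : Matrix ι ι ℝ))))ᵀ * (csavg M (L ^ m * L ^ k) (fun (_ : Fin (d + 1)) (_ : Tor (fine (L ^ m * L ^ k) M)) => (1 : Matrix ι ι ℝ))) - ((csavg M (L ^ m * L ^ k) T'))ᵀ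 * (csavg M (L ^ m * L ^ k) T')))) ∘ₗ Matrix.mulVecLin (cGreen M (L ^ m * L ^ k) T' a'))) + Matrix.mulVecLin ((cgrad M (L ^ m * L ^ k) (fun (_ : Fin (d + 1)) (_ : Tor (fine (L ^ m * L ^ k) M)) => (1 : Matrix ι ι ℝ))) * (cGreen M (L ^ m * L ^ k) (fun (_ : Fin (d + 1)) (_ : Tor (fine (L ^ m * L ^ k) M)) => (1 : Matrix ι ι ℝ)) a')) ∘ₗ ((Matrix.mulVecLin (((cgrad M (L ^ m * L ^ k) (fun (_ : Fin (d + 1)) (_ : Tor (fine (L ^ m * L ^ k) M)) => (1 : Matrix ι ι ℝ))) - cgrad M (L ^ m * L ^ k) T'))ᵀ - Matrix.mulVecLin (bContr M (L ^ m * L ^ k) (fun ν x => (((L ^ m * L ^ k : ℕ) : ℝ)) • ((1 : Matrix ι ι ℝ) - T' ν x)))) ∘ₗ Matrix.mulVecLin ((cgrad M (L ^ m * L ^ k) (fun (_ : Fin (d + 1)) (_ : Tor (fine (L ^ m * L ^ k) M)) => (1 : Matrix ι ι ℝ))) * (cGreen M (L ^ m * L ^ k) T' a'))) := by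
    have hL := cgrad_one_transpose_comp_B M (L ^ m * L ^ k) T'
    have hM : ((cgrad M (L ^ m * L ^ k) (fun (_ : Fin (d + 1)) (_ : Tor (fine (L ^ m * L ^ k) M)) => (1 : Matrix ι ι ℝ))) * (cGreen M (L ^ m * L ^ k) T' a')) = ((cgrad M (L ^ m * L ^ k) (fun (_ : Fin (d + 1)) (_ : Tor (fine (L ^ m * L ^ k) M)) => (1 : Matrix ι ι ℝ))) * (cGreen M (L ^ m * L ^ k) (fun (_ : Fin (d + 1)) (_ : Tor (fine (L ^ m * L ^ k) M)) => (1 : Matrix ι ι ℝ)) a')) + ((cgrad M (L ^ m * L ^ k) (fun (_ : Fin (d + 1)) (_ : Tor (fine (L ^ m * L ^ k) M)) => (1 : Matrix ι ι ℝ))) * (cGreen M (L ^ m * L ^ k) (fun (_ : Fin (d + 1)) (_ : Tor (fine (L ^ m * L ^ k) M)) => (1 : Matrix ι ι ℝ)) a')) * ((claplA M (L ^ m * L ^ k) (fun (_ : Fin (d + 1)) (_ : Tor (fine (L ^ m * L ^ k) M)) => (1 : Matrix ι ι ℝ)) a' - claplA M (L ^ m * L ^ k) T' a') * (cGreen M (L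 ^ m * L ^ k) T' a')) := by
      conv_lhs => rw [cGreen_eq_one_add_step_mul M (L ^ m * L ^ k) hT' ha']
      simp only [Matrix.mul_add, Matrix.mul_assoc]
    set DG1m := ((cgrad M (L ^ m * L ^ k) (fun (_ : Fin (d + 1)) (_ : Tor (fine (L ^ m * L ^ k) M)) => (1 : Matrix ι ι ℝ))) * (cGreen M (L ^ m * L ^ k) (fun (_ : Fin (d + 1)) (_ : Tor (fine (L ^ m * L ^ k) M)) => (1 : Matrix ι ι ℝ)) a')) with hDG1m
    set Bm := ((cgrad M (L ^ m * L ^ k) (fun (_ : Fin (d + 1)) (_ : Tor (fine (L ^ m * L ^ k) M)) => (1 : Matrix ι ι ℝ))) - cgrad M (L ^ m * L ^ k) T') with hBm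
    conv_lhs => rw [hM, claplA_one_sub_claplA, ← hBm, hBB']
    simp only [Matrix.mulVecLin_add, mulVecLin_sub', Matrix.mulVecLin_mul]
    rw [hL]
    simp only [LinearMap.comp_add, LinearMap.comp_sub, LinearMap.add_comp, LinearMap.sub_comp, LinearMap.comp_assoc]
    abel
  have hKZeq : (Matrix.mulVecLin (((cgrad M (L ^ k) (fun (_ : Fin (d + 1)) (_ : Tor (fine (L ^ k) M)) => (1 : Matrix ι ι ℝ))) - cgrad M (L ^ k) T))ᵀ - Matrix.mulVecLin (bContr M (L ^ k) (fun ν x => (((L ^ k : ℕ) : ℝ)) • ((1 : Matrix ι ι ℝ) - T ν x)))) ∘ₗ Matrix.mulVecLin ((cgrad M (L ^ k) (fun (_ : Fin (d + 1)) (_ : Tor (fine (L ^ k) M)) => (1 : Matrix ι ι ℝ))) * (cGreen M (L ^ k) (fun (_ : Fin (d + 1)) (_ : Tor (fine (L ^ k) M)) => (1 : Matrix ι ι ℝ)) a)) = (Matrix.mulVecLin (bContr M (L ^ k) (fun μ z => ((((L ^ k : ℕ) : ℝ)) • ((1 : Matrix ι ι ℝ) - T μ (z - unitVec (fine (L ^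 k) M) μ)))ᵀ)) ∘ₗ Matrix.mulVecLin ((bBack M (L ^ k) (ι := ι)) * ((cgrad M (L ^ k) (fun (_ : Fin (d + 1)) (_ : Tor (fine (L ^ k) M)) => (1 : Matrix ι ι ℝ))) * (cGreen M (L ^ k) (fun (_ : Fin (d + 1)) (_ : Tor (fine (L ^ k) M)) => (1 : Matrix ι ι ℝ)) a))) - Matrix.mulVecLin (bContr M (L ^ k) (fun ν x => (((L ^ k : ℕ) : ℝ)) • ((1 : Matrix ι ι ℝ) - T ν x))) ∘ₗ Matrix.mulVecLin ((cgrad M (L ^ k) (fun (_ : Fin (d + 1)) (_ : Tor (fine (L ^ k) M)) => (1 : Matrix ι ι ℝ))) * (cGreen M (L ^ k) (fun (_ : Fin (d + 1)) (_ : Tor (fine (L ^ k) M)) => (1 : Matrix ι ι ℝ)) a))) := by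
    rw [LinearMap.sub_comp, cgrad_one_sub_eq_bMulShift, mulVecLin_bMulShift_transpose, LinearMap.comp_assoc, ← Matrix.mulVecLin_mul (bBack M (L ^ k) (ι := ι)) ((cgrad M (L ^ k) (fun (_ : Fin (d + 1)) (_ : Tor (fine (L ^ k) M)) => (1 : Matrix ι ι ℝ))) * (cGreen M (L ^ k) (fun (_ : Fin (d + 1)) (_ : Tor (fine (L ^ k) M)) => (1 : Matrix ι ι ℝ)) a))]
  have hKZeq' : (Matrix.mulVecLin (((cgrad M (L ^ m * L ^ k) (fun (_ : Fin (d + 1)) (_ : Tor (fine (L ^ m * L ^ k) M)) => (1 : Matrix ι ι ℝ))) - cgrad M (L ^ m * L ^ k) T'))ᵀ - Matrix.mulVecLin (bContr M (L ^ m * L ^ k) (fun ν x => (((L ^ m * L ^ k : ℕ) : ℝ)) • ((1 : Matrix ι ι ℝ) - T' ν x)))) ∘ₗ Matrix.mulVecLin ((cgrad M (L ^ m * L ^ k) (fun (_ : Fin (d + 1)) (_ : Tor (fine (L ^ m * L ^ k) M)) => (1 : Matrix ι ι ℝ))) * (cGreen M (L ^ m * L ^ k) (fun (_ : Fin (d +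 1)) (_ : Tor (fine (L ^ m * L ^ k) M)) => (1 : Matrix ι ι ℝ)) a')) = (Matrix.mulVecLin (bContr M (L ^ m * L ^ k) (fun μ z => ((((L ^ m * L ^ k : ℕ) : ℝ)) • ((1 : Matrix ι ι ℝ) - T' μ (z - unitVec (fine (L ^ m * L ^ k) M) μ)))ᵀ)) ∘ₗ Matrix.mulVecLin ((bBack M (L ^ m * L ^ k) (ι := ι)) * ((cgrad M (L ^ m * L ^ k) (fun (_ : Fin (d + 1)) (_ : Tor (fine (L ^ m * L ^ k) M)) => (1 : Matrix ι ι ℝ))) * (cGreen M (L ^ m * L ^ k) (fun (_ : Fin (d + 1)) (_ : Tor (fine (L ^ m * L ^ k) M)) => (1 : Matrix ι ι ℝ)) a'))) - Matrix.mulVecLin (bContr M (L ^ m * L ^ k) (fun ν x => (((L ^ m * L ^ k : ℕ) : ℝ)) • ((1 : Matrix ι ι ℝ) - T' ν x))) ∘ₗ Matrix.mulVecLin ((cgrad M (L ^ m * L ^ k) (fun (_ : Fin (d + 1)) (_ : Tor (fine (L ^ m * L ^ k) M)) => (1 : Matrix ι ι ℝ))) * (cGreen M (L ^ m * L ^ k)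 (fun (_ : Fin (d + 1)) (_ : Tor (fine (L ^ m * L ^ k) M)) => (1 : Matrix ι ι ℝ)) a'))) := by
    rw [LinearMap.sub_comp, cgrad_one_sub_eq_bMulShift, mulVecLin_bMulShift_transpose, LinearMap.comp_assoc, ← Matrix.mulVecLin_mul (bBack M (L ^ m * L ^ k) (ι := ι)) ((cgrad M (L ^ m * L ^ k) (fun (_ : Fin (d + 1)) (_ : Tor (fine (L ^ m * L ^ k) M)) => (1 : Matrix ι ι ℝ))) * (cGreen M (L ^ m * L ^ k) (fun (_ : Fin (d + 1)) (_ : Tor (fine (L ^ m * L ^ k) M)) => (1 : Matrix ι ι ℝ)) a'))]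
  have hfixZ : ((Matrix.mulVecLin (((cgrad M (L ^ k) (fun (_ : Fin (d + 1)) (_ : Tor (fine (L ^ k) M)) => (1 : Matrix ι ι ℝ))) - cgrad M (L ^ k) T))ᵀ - Matrix.mulVecLin (bContr M (L ^ k) (fun ν x => (((L ^ k : ℕ) : ℝ)) • ((1 : Matrix ι ι ℝ) - T ν x)))) ∘ₗ Matrix.mulVecLin ((cgrad M (L ^ k) (fun (_ : Fin (d + 1)) (_ : Tor (fine (L ^ k) M)) => (1 : Matrix ι ι ℝ))) * (cGreen M (L ^ k) T a))) = ((Matrix.mulVecLin (bContr M (L ^ k) (fun μ z => ((((L ^ k : ℕ) : ℝ)) • ((1 : Matrix ι ι ℝ) - T μ (z - unitVec (fine (L ^ k) M) μ)))ᵀ)) ∘ₗ Matrix.mulVecLin ((bBack M (L ^ k) (ι := ι)) * ((cgrad M (L ^ k) (fun (_ : Fin (d + 1)) (_ : Tor (fine (L ^ k) M)) => (1 : Matrix ι ι ℝ))) * (cGreen M (L ^ k) (fun (_ : Fin (d + 1)) (_ : Tor (fine (L ^ k) M)) => (1 : Matrix ι ι ℝ)) a))) - Matrix.mulVecLin (bContr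 M (L ^ k) (fun ν x => (((L ^ k : ℕ) : ℝ)) • ((1 : Matrix ι ι ℝ) - T ν x))) ∘ₗ Matrix.mulVecLin ((cgrad M (L ^ k) (fun (_ : Fin (d + 1)) (_ : Tor (fine (L ^ k) M)) => (1 : Matrix ι ι ℝ))) * (cGreen M (L ^ k) (fun (_ : Fin (d + 1)) (_ : Tor (fine (L ^ k) M)) => (1 : Matrix ι ι ℝ)) a))) + (Matrix.mulVecLin (bContr M (L ^ k) (fun μ z => ((((L ^ k : ℕ) : ℝ)) • ((1 : Matrix ι ι ℝ) - T μ (z - unitVec (fine (L ^ k) M) μ)))ᵀ)) ∘ₗ Matrix.mulVecLin ((bBack M (L ^ k) (ι := ι)) * ((cgrad M (L ^ k) (fun (_ : Fin (d + 1)) (_ : Tor (fine (L ^ k) M)) => (1 : Matrix ι ι ℝ))) * (cGreen M (L ^ k) (fun (_ : Fin (d + 1)) (_ : Tor (fine (L ^ k) M)) => (1 : Matrix ι ι ℝ)) a))) - Matrix.mulVecLin (bContr M (L ^ k) (fun ν x => (((L ^ k : ℕ) : ℝ)) • ((1 : Matrix ι ι ℝ) - T ν x))) ∘ₗ Matrix.mulVecLin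 ((cgrad M (L ^ k) (fun (_ : Fin (d + 1)) (_ : Tor (fine (L ^ k) M)) => (1 : Matrix ι ι ℝ))) * (cGreen M (L ^ k) (fun (_ : Fin (d + 1)) (_ : Tor (fine (L ^ k) M)) => (1 : Matrix ι ι ℝ)) a))) ∘ₗ ((Matrix.mulVecLin (sDiag M (L ^ k) (bDiv M (L ^ k) (fun ν x => (((L ^ k : ℕ) : ℝ)) • ((1 : Matrix ι ι ℝ) - T ν x)))) - Matrix.mulVecLin (sDiag M (L ^ k) (fun z => ∑ μ, ((fun ν x => (((L ^ k : ℕ) : ℝ)) • ((1 : Matrix ι ι ℝ) - T ν x)) μ (z - unitVec (fine (L ^ k) M) μ))ᵀ * (fun ν x => (((L ^ k : ℕ) : ℝ)) • ((1 : Matrix ι ι ℝ) - T ν x)) μ (z - unitVec (fine (L ^ k) M) μ))) + Matrix.mulVecLin (a • (((csavg M (L ^ k) (fun (_ : Fin (d + 1)) (_ : Tor (fine (L ^ k) M)) => (1 : Matrix ι ι ℝ))))ᵀ * (csavg M (L ^ k) (fun (_ : Fin (d + 1)) (_ : Tor (fine (L ^ k) M)) => (1 : Matrix ι ι ℝ)))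 - ((csavg M (L ^ k) T))ᵀ * (csavg M (L ^ k) T)))) ∘ₗ Matrix.mulVecLin (cGreen M (L ^ k) T a))) + (Matrix.mulVecLin (bContr M (L ^ k) (fun μ z => ((((L ^ k : ℕ) : ℝ)) • ((1 : Matrix ι ι ℝ) - T μ (z - unitVec (fine (L ^ k) M) μ)))ᵀ)) ∘ₗ Matrix.mulVecLin ((bBack M (L ^ k) (ι := ι)) * ((cgrad M (L ^ k) (fun (_ : Fin (d + 1)) (_ : Tor (fine (L ^ k) M)) => (1 : Matrix ι ι ℝ))) * (cGreen M (L ^ k) (fun (_ : Fin (d + 1)) (_ : Tor (fine (L ^ k) M)) => (1 : Matrix ι ι ℝ)) a))) - Matrix.mulVecLin (bContr M (L ^ k) (fun ν x => (((L ^ k : ℕ) : ℝ)) • ((1 : Matrix ι ι ℝ) - T ν x))) ∘ₗ Matrix.mulVecLin ((cgrad M (L ^ k) (fun (_ : Fin (d + 1)) (_ : Tor (fine (L ^ k) M)) => (1 : Matrix ι ι ℝ))) * (cGreen M (L ^ k) (fun (_ : Fin (d + 1)) (_ : Tor (fine (L ^ k) M)) => (1 : Matrix ι ι ℝ)) a)))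 ∘ₗ ((Matrix.mulVecLin (((cgrad M (L ^ k) (fun (_ : Fin (d + 1)) (_ : Tor (fine (L ^ k) M)) => (1 : Matrix ι ι ℝ))) - cgrad M (L ^ k) T))ᵀ - Matrix.mulVecLin (bContr M (L ^ k) (fun ν x => (((L ^ k : ℕ) : ℝ)) • ((1 : Matrix ι ι ℝ) - T ν x)))) ∘ₗ Matrix.mulVecLin ((cgrad M (L ^ k) (fun (_ : Fin (d + 1)) (_ : Tor (fine (L ^ k) M)) => (1 : Matrix ι ι ℝ))) * (cGreen M (L ^ k) T a))) := by
    have h1 : ((Matrix.mulVecLin (((cgrad M (L ^ k) (fun (_ : Fin (d + 1)) (_ : Tor (fine (L ^ k) M)) => (1 : Matrix ι ι ℝ))) - cgrad M (L ^ k) T))ᵀ - Matrix.mulVecLin (bContr M (L ^ k) (fun ν x => (((L ^ k : ℕ) : ℝ)) • ((1 : Matrix ι ι ℝ) - T ν x)))) ∘ₗ Matrix.mulVecLin ((cgrad M (L ^ k) (fun (_ : Fin (d + 1)) (_ : Tor (fine (L ^ k) M)) => (1 : Matrix ι ι ℝ))) * (cGreen M (L ^ k) T a))) = (Matrix.mulVecLin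 (((cgrad M (L ^ k) (fun (_ : Fin (d + 1)) (_ : Tor (fine (L ^ k) M)) => (1 : Matrix ι ι ℝ))) - cgrad M (L ^ k) T))ᵀ - Matrix.mulVecLin (bContr M (L ^ k) (fun ν x => (((L ^ k : ℕ) : ℝ)) • ((1 : Matrix ι ι ℝ) - T ν x)))) ∘ₗ ((Matrix.mulVecLin ((cgrad M (L ^ k) (fun (_ : Fin (d + 1)) (_ : Tor (fine (L ^ k) M)) => (1 : Matrix ι ι ℝ))) * (cGreen M (L ^ k) (fun (_ : Fin (d + 1)) (_ : Tor (fine (L ^ k) M)) => (1 : Matrix ι ι ℝ)) a)) + Matrix.mulVecLin ((cgrad M (L ^ k) (fun (_ : Fin (d + 1)) (_ : Tor (fine (L ^ k) M)) => (1 : Matrix ι ι ℝ))) * (cGreen M (L ^ k) (fun (_ : Fin (d + 1)) (_ : Tor (fine (L ^ k) M)) => (1 : Matrix ι ι ℝ)) a)) ∘ₗ ((Matrix.mulVecLin (sDiag M (L ^ k) (bDiv M (L ^ k) (fun ν x => (((L ^ k : ℕ) : ℝ)) • ((1 : Matrix ι ι ℝ) - T ν x)))) - Matrix.mulVecLin (sDiag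 M (L ^ k) (fun z => ∑ μ, ((fun ν x => (((L ^ k : ℕ) : ℝ)) • ((1 : Matrix ι ι ℝ) - T ν x)) μ (z - unitVec (fine (L ^ k) M) μ))ᵀ * (fun ν x => (((L ^ k : ℕ) : ℝ)) • ((1 : Matrix ι ι ℝ) - T ν x)) μ (z - unitVec (fine (L ^ k) M) μ))) + Matrix.mulVecLin (a • (((csavg M (L ^ k) (fun (_ : Fin (d + 1)) (_ : Tor (fine (L ^ k) M)) => (1 : Matrix ι ι ℝ))))ᵀ * (csavg M (L ^ k) (fun (_ : Fin (d + 1)) (_ : Tor (fine (L ^ k) M)) => (1 : Matrix ι ι ℝ))) - ((csavg M (L ^ k) T))ᵀ * (csavg M (L ^ k) T)))) ∘ₗ Matrix.mulVecLin (cGreen M (L ^ k) T a))) + Matrix.mulVecLin ((cgrad M (L ^ k) (fun (_ : Fin (d + 1)) (_ : Tor (fine (L ^ k) M)) => (1 : Matrix ι ι ℝ))) * (cGreen M (L ^ k) (fun (_ : Fin (d + 1)) (_ : Tor (fine (L ^ k) M)) => (1 : Matrix ι ι ℝ)) a)) ∘ₗ ((Matrix.mulVecLin (((cgrad M (L ^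 k) (fun (_ : Fin (d + 1)) (_ : Tor (fine (L ^ k) M)) => (1 : Matrix ι ι ℝ))) - cgrad M (L ^ k) T))ᵀ - Matrix.mulVecLin (bContr M (L ^ k) (fun ν x => (((L ^ k : ℕ) : ℝ)) • ((1 : Matrix ι ι ℝ) - T ν x)))) ∘ₗ Matrix.mulVecLin ((cgrad M (L ^ k) (fun (_ : Fin (d + 1)) (_ : Tor (fine (L ^ k) M)) => (1 : Matrix ι ι ℝ))) * (cGreen M (L ^ k) T a)))) := by
      conv_lhs => rw [hA1]
    conv_lhs => rw [h1]
    rw [← hKZeq]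
    simp only [LinearMap.comp_add, LinearMap.comp_assoc]
  have hfixZ' : ((Matrix.mulVecLin (((cgrad M (L ^ m * L ^ k) (fun (_ : Fin (d + 1)) (_ : Tor (fine (L ^ m * L ^ k) M)) => (1 : Matrix ι ι ℝ))) - cgrad M (L ^ m * L ^ k) T'))ᵀ - Matrix.mulVecLin (bContr M (L ^ m * L ^ k) (fun ν x => (((L ^ m * L ^ k : ℕ) : ℝ)) • ((1 : Matrix ι ι ℝ) - T' ν x)))) ∘ₗ Matrix.mulVecLin ((cgrad M (L ^ m * L ^ k) (fun (_ : Fin (d + 1)) (_ : Tor (fine (L ^ m * L ^ k) M)) => (1 : Matrix ι ι ℝ))) * (cGreen M (L ^ m * L ^ k) T' a'))) = ((Matrix.mulVecLin (bContr M (L ^ m * L ^ k) (fun μ z => ((((L ^ m * L ^ k : ℕ) : ℝ)) • ((1 : Matrix ι ι ℝ) - T' μ (z - unitVec (fine (L ^ m * L ^ k) M) μ)))ᵀ)) ∘ₗ Matrix.mulVecLin ((bBack M (L ^ m * L ^ k) (ι := ι)) * ((cgrad M (L ^ m * L ^ k) (fun (_ : Fin (d + 1)) (_ : Tor (fine (L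 ^ m * L ^ k) M)) => (1 : Matrix ι ι ℝ))) * (cGreen M (L ^ m * L ^ k) (fun (_ : Fin (d + 1)) (_ : Tor (fine (L ^ m * L ^ k) M)) => (1 : Matrix ι ι ℝ)) a'))) - Matrix.mulVecLin (bContr M (L ^ m * L ^ k) (fun ν x => (((L ^ m * L ^ k : ℕ) : ℝ)) • ((1 : Matrix ι ι ℝ) - T' ν x))) ∘ₗ Matrix.mulVecLin ((cgrad M (L ^ m * L ^ k) (fun (_ : Fin (d + 1)) (_ : Tor (fine (L ^ m * L ^ k) M)) => (1 : Matrix ι ι ℝ))) * (cGreen M (L ^ m * L ^ k) (fun (_ : Fin (d + 1)) (_ : Tor (fine (L ^ m * L ^ k) M)) => (1 : Matrix ι ι ℝ)) a'))) + (Matrix.mulVecLin (bContr M (L ^ m * L ^ k) (fun μ z => ((((L ^ m * L ^ k : ℕ) : ℝ)) • ((1 : Matrix ι ι ℝ) - T' μ (z - unitVec (fine (L ^ m * L ^ k) M) μ)))ᵀ)) ∘ₗ Matrix.mulVecLin ((bBack M (L ^ m * L ^ k) (ι := ι)) * ((cgrad M (L ^ m * L ^ k) (fun (_ : Fin (d +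 1)) (_ : Tor (fine (L ^ m * L ^ k) M)) => (1 : Matrix ι ι ℝ))) * (cGreen M (L ^ m * L ^ k) (fun (_ : Fin (d + 1)) (_ : Tor (fine (L ^ m * L ^ k) M)) => (1 : Matrix ι ι ℝ)) a'))) - Matrix.mulVecLin (bContr M (L ^ m * L ^ k) (fun ν x => (((L ^ m * L ^ k : ℕ) : ℝ)) • ((1 : Matrix ι ι ℝ) - T' ν x))) ∘ₗ Matrix.mulVecLin ((cgrad M (L ^ m * L ^ k) (fun (_ : Fin (d + 1)) (_ : Tor (fine (L ^ m * L ^ k) M)) => (1 : Matrix ι ι ℝ))) * (cGreen M (L ^ m * L ^ k) (fun (_ : Fin (d + 1)) (_ : Tor (fine (L ^ m * L ^ k) M)) => (1 : Matrix ι ι ℝ)) a'))) ∘ₗ ((Matrix.mulVecLin (sDiag M (L ^ m * L ^ k) (bDiv M (L ^ m * L ^ k) (fun ν x => (((L ^ m * L ^ k : ℕ) : ℝ)) • ((1 : Matrix ι ι ℝ) - T' ν x)))) - Matrix.mulVecLin (sDiag M (L ^ m * L ^ k) (fun z => ∑ μ, ((fun ν x => (((L ^ m * L ^ k : ℕ)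 : ℝ)) • ((1 : Matrix ι ι ℝ) - T' ν x)) μ (z - unitVec (fine (L ^ m * L ^ k) M) μ))ᵀ * (fun ν x => (((L ^ m * L ^ k : ℕ) : ℝ)) • ((1 : Matrix ι ι ℝ) - T' ν x)) μ (z - unitVec (fine (L ^ m * L ^ k) M) μ))) + Matrix.mulVecLin (a' • (((csavg M (L ^ m * L ^ k) (fun (_ : Fin (d + 1)) (_ : Tor (fine (L ^ m * L ^ k) M)) => (1 : Matrix ι ι ℝ))))ᵀ * (csavg M (L ^ m * L ^ k) (fun (_ : Fin (d + 1)) (_ : Tor (fine (L ^ m * L ^ k) M)) => (1 : Matrix ι ι ℝ))) - ((csavg M (L ^ m * L ^ k) T'))ᵀ * (csavg M (L ^ m * L ^ k) T')))) ∘ₗ Matrix.mulVecLin (cGreen M (L ^ m * L ^ k) T' a'))) + (Matrix.mulVecLin (bContr M (L ^ m * L ^ k) (fun μ z => ((((L ^ m * L ^ k : ℕ) : ℝ)) • ((1 : Matrix ι ι ℝ) - T' μ (z - unitVec (fine (L ^ m * L ^ k) M) μ)))ᵀ)) ∘ₗ Matrix.mulVecLin ((bBack M (L ^ m * L ^ k)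 (ι := ι)) * ((cgrad M (L ^ m * L ^ k) (fun (_ : Fin (d + 1)) (_ : Tor (fine (L ^ m * L ^ k) M)) => (1 : Matrix ι ι ℝ))) * (cGreen M (L ^ m * L ^ k) (fun (_ : Fin (d + 1)) (_ : Tor (fine (L ^ m * L ^ k) M)) => (1 : Matrix ι ι ℝ)) a'))) - Matrix.mulVecLin (bContr M (L ^ m * L ^ k) (fun ν x => (((L ^ m * L ^ k : ℕ) : ℝ)) • ((1 : Matrix ι ι ℝ) - T' ν x))) ∘ₗ Matrix.mulVecLin ((cgrad M (L ^ m * L ^ k) (fun (_ : Fin (d + 1)) (_ : Tor (fine (L ^ m * L ^ k) M)) => (1 : Matrix ι ι ℝ))) * (cGreen M (L ^ m * L ^ k) (fun (_ : Fin (d + 1)) (_ : Tor (fine (L ^ m * L ^ k) M)) => (1 : Matrix ι ι ℝ)) a'))) ∘ₗ ((Matrix.mulVecLin (((cgrad M (L ^ m * L ^ k) (fun (_ : Fin (d + 1)) (_ : Tor (fine (L ^ m * L ^ k) M)) => (1 : Matrix ι ι ℝ))) - cgrad M (L ^ m * L ^ k) T'))ᵀ - Matrix.mulVecLin (bContr M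 (L ^ m * L ^ k) (fun ν x => (((L ^ m * L ^ k : ℕ) : ℝ)) • ((1 : Matrix ι ι ℝ) - T' ν x)))) ∘ₗ Matrix.mulVecLin ((cgrad M (L ^ m * L ^ k) (fun (_ : Fin (d + 1)) (_ : Tor (fine (L ^ m * L ^ k) M)) => (1 : Matrix ι ι ℝ))) * (cGreen M (L ^ m * L ^ k) T' a'))) := by
    have h1 : ((Matrix.mulVecLin (((cgrad M (L ^ m * L ^ k) (fun (_ : Fin (d + 1)) (_ : Tor (fine (L ^ m * L ^ k) M)) => (1 : Matrix ι ι ℝ))) - cgrad M (L ^ m * L ^ k) T'))ᵀ - Matrix.mulVecLin (bContr M (L ^ m * L ^ k) (fun ν x => (((L ^ m * L ^ k : ℕ) : ℝ)) • ((1 : Matrix ι ι ℝ) - T' ν x)))) ∘ₗ Matrix.mulVecLin ((cgrad M (L ^ m * L ^ k) (fun (_ : Fin (d + 1)) (_ : Tor (fine (L ^ m * L ^ k) M)) => (1 : Matrix ι ι ℝ))) * (cGreen M (L ^ m * L ^ k) T' a'))) = (Matrix.mulVecLin (((cgrad M (L ^ m * L ^ k) (fun (_ : Fin (d + 1)) (_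 : Tor (fine (L ^ m * L ^ k) M)) => (1 : Matrix ι ι ℝ))) - cgrad M (L ^ m * L ^ k) T'))ᵀ - Matrix.mulVecLin (bContr M (L ^ m * L ^ k) (fun ν x => (((L ^ m * L ^ k : ℕ) : ℝ)) • ((1 : Matrix ι ι ℝ) - T' ν x)))) ∘ₗ ((Matrix.mulVecLin ((cgrad M (L ^ m * L ^ k) (fun (_ : Fin (d + 1)) (_ : Tor (fine (L ^ m * L ^ k) M)) => (1 : Matrix ι ι ℝ))) * (cGreen M (L ^ m * L ^ k) (fun (_ : Fin (d + 1)) (_ : Tor (fine (L ^ m * L ^ k) M)) => (1 : Matrix ι ι ℝ)) a')) + Matrix.mulVecLin ((cgrad M (L ^ m * L ^ k) (fun (_ : Fin (d + 1)) (_ : Tor (fine (L ^ m * L ^ k) M)) => (1 : Matrix ι ι ℝ))) * (cGreen M (L ^ m * L ^ k) (fun (_ : Fin (d + 1)) (_ : Tor (fine (L ^ m * L ^ k) M)) => (1 : Matrix ι ι ℝ)) a')) ∘ₗ ((Matrix.mulVecLin (sDiag M (L ^ m * L ^ k) (bDiv M (L ^ m * L ^ k) (fun ν x => (((L ^ m *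 L ^ k : ℕ) : ℝ)) • ((1 : Matrix ι ι ℝ) - T' ν x)))) - Matrix.mulVecLin (sDiag M (L ^ m * L ^ k) (fun z => ∑ μ, ((fun ν x => (((L ^ m * L ^ k : ℕ) : ℝ)) • ((1 : Matrix ι ι ℝ) - T' ν x)) μ (z - unitVec (fine (L ^ m * L ^ k) M) μ))ᵀ * (fun ν x => (((L ^ m * L ^ k : ℕ) : ℝ)) • ((1 : Matrix ι ι ℝ) - T' ν x)) μ (z - unitVec (fine (L ^ m * L ^ k) M) μ))) + Matrix.mulVecLin (a' • (((csavg M (L ^ m * L ^ k) (fun (_ : Fin (d + 1)) (_ : Tor (fine (L ^ m * L ^ k) M)) => (1 : Matrix ι ι ℝ))))ᵀ * (csavg M (L ^ m * L ^ k) (fun (_ : Fin (d + 1)) (_ : Tor (fine (L ^ m * L ^ k) M)) => (1 : Matrix ι ι ℝ))) - ((csavg M (L ^ m * L ^ k) T'))ᵀ * (csavg M (L ^ m * L ^ k) T')))) ∘ₗ Matrix.mulVecLin (cGreen M (L ^ m * L ^ k) T' a'))) + Matrix.mulVecLin ((cgrad M (L ^ m * L ^ k) (fun (_ : Fin (d +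 1)) (_ : Tor (fine (L ^ m * L ^ k) M)) => (1 : Matrix ι ι ℝ))) * (cGreen M (L ^ m * L ^ k) (fun (_ : Fin (d + 1)) (_ : Tor (fine (L ^ m * L ^ k) M)) => (1 : Matrix ι ι ℝ)) a')) ∘ₗ ((Matrix.mulVecLin (((cgrad M (L ^ m * L ^ k) (fun (_ : Fin (d + 1)) (_ : Tor (fine (L ^ m * L ^ k) M)) => (1 : Matrix ι ι ℝ))) - cgrad M (L ^ m * L ^ k) T'))ᵀ - Matrix.mulVecLin (bContr M (L ^ m * L ^ k) (fun ν x => (((L ^ m * L ^ k : ℕ) : ℝ)) • ((1 : Matrix ι ι ℝ) - T' ν x)))) ∘ₗ Matrix.mulVecLin ((cgrad M (L ^ m * L ^ k) (fun (_ : Fin (d + 1)) (_ : Tor (fine (L ^ m * L ^ k) M)) => (1 : Matrix ι ι ℝ))) * (cGreen M (L ^ m * L ^ k) T' a')))) := by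
      conv_lhs => rw [hA1']
    conv_lhs => rw [h1]
    rw [← hKZeq']
    simp only [LinearMap.comp_add, LinearMap.comp_assoc]
  -- ### the scalar Neumann series for `𝔇(Z′, Z)`
  have hSrcZ : HasMaj (BlockNorm.ofBlocks (unitTorusGeo L k M) (liftBlk (blockOf (L ^ k) M) ι)) (BlockNorm.ofBlocks (unitTorusGeo L k M) (liftBlk (blockOf (L ^ m * L ^ k) M) ι)) (idef (pull (liftMap (kingPr L k m M) ι)) (pull (liftMap (kingPr L k m M) ι)) ((Matrix.mulVecLin (bContr M (L ^ m * L ^ k) (fun μ z => ((((L ^ m * L ^ k : ℕ) : ℝ)) • ((1 : Matrix ι ι ℝ) - T' μ (z - unitVec (fine (L ^ m * L ^ k) M) μ)))ᵀ)) ∘ₗ Matrix.mulVecLin ((bBack M (L ^ m * L ^ k) (ι := ι)) * ((cgrad M (L ^ m * L ^ k) (fun (_ : Fin (d + 1)) (_ : Tor (fine (L ^ m * L ^ k) M)) => (1 : Matrix ι ι ℝ))) * (cGreen M (L ^ m * L ^ k) (fun (_ : Fin (d + 1)) (_ : Tor (fine (L ^ m * L ^ k) M)) => (1 : Matrix ι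 ι ℝ)) a'))) - Matrix.mulVecLin (bContr M (L ^ m * L ^ k) (fun ν x => (((L ^ m * L ^ k : ℕ) : ℝ)) • ((1 : Matrix ι ι ℝ) - T' ν x))) ∘ₗ Matrix.mulVecLin ((cgrad M (L ^ m * L ^ k) (fun (_ : Fin (d + 1)) (_ : Tor (fine (L ^ m * L ^ k) M)) => (1 : Matrix ι ι ℝ))) * (cGreen M (L ^ m * L ^ k) (fun (_ : Fin (d + 1)) (_ : Tor (fine (L ^ m * L ^ k) M)) => (1 : Matrix ι ι ℝ)) a'))) + (Matrix.mulVecLin (bContr M (L ^ m * L ^ k) (fun μ z => ((((L ^ m * L ^ k : ℕ) : ℝ)) • ((1 : Matrix ι ι ℝ) - T' μ (z - unitVec (fine (L ^ m * L ^ k) M) μ)))ᵀ)) ∘ₗ Matrix.mulVecLin ((bBack M (L ^ m * L ^ k) (ι := ι)) * ((cgrad M (L ^ m * L ^ k) (fun (_ : Fin (d + 1)) (_ : Tor (fine (L ^ m * L ^ k) M)) => (1 : Matrix ι ι ℝ))) * (cGreen M (L ^ m * L ^ k) (fun (_ : Fin (d + 1)) (_ : Tor (fine (L ^ m * L ^ k)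 M)) => (1 : Matrix ι ι ℝ)) a'))) - Matrix.mulVecLin (bContr M (L ^ m * L ^ k) (fun ν x => (((L ^ m * L ^ k : ℕ) : ℝ)) • ((1 : Matrix ι ι ℝ) - T' ν x))) ∘ₗ Matrix.mulVecLin ((cgrad M (L ^ m * L ^ k) (fun (_ : Fin (d + 1)) (_ : Tor (fine (L ^ m * L ^ k) M)) => (1 : Matrix ι ι ℝ))) * (cGreen M (L ^ m * L ^ k) (fun (_ : Fin (d + 1)) (_ : Tor (fine (L ^ m * L ^ k) M)) => (1 : Matrix ι ι ℝ)) a'))) ∘ₗ ((Matrix.mulVecLin (sDiag M (L ^ m * L ^ k) (bDiv M (L ^ m * L ^ k) (fun ν x => (((L ^ m * L ^ k : ℕ) : ℝ)) • ((1 : Matrix ι ι ℝ) - T' ν x)))) - Matrix.mulVecLin (sDiag M (L ^ m * L ^ k) (fun z => ∑ μ, ((fun ν x => (((L ^ m * L ^ k : ℕ) : ℝ)) • ((1 : Matrix ι ι ℝ) - T' ν x)) μ (z - unitVec (fine (L ^ m * L ^ k) M) μ))ᵀ * (fun ν x => (((L ^ m * L ^ k : ℕ) : ℝ)) • ((1 :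 Matrix ι ι ℝ) - T' ν x)) μ (z - unitVec (fine (L ^ m * L ^ k) M) μ))) + Matrix.mulVecLin (a' • (((csavg M (L ^ m * L ^ k) (fun (_ : Fin (d + 1)) (_ : Tor (fine (L ^ m * L ^ k) M)) => (1 : Matrix ι ι ℝ))))ᵀ * (csavg M (L ^ m * L ^ k) (fun (_ : Fin (d + 1)) (_ : Tor (fine (L ^ m * L ^ k) M)) => (1 : Matrix ι ι ℝ))) - ((csavg M (L ^ m * L ^ k) T'))ᵀ * (csavg M (L ^ m * L ^ k) T')))) ∘ₗ Matrix.mulVecLin (cGreen M (L ^ m * L ^ k) T' a'))) ((Matrix.mulVecLin (bContr M (L ^ k) (fun μ z => ((((L ^ k : ℕ) : ℝ)) • ((1 : Matrix ι ι ℝ) - T μ (z - unitVec (fine (L ^ k) M) μ)))ᵀ)) ∘ₗ Matrix.mulVecLin ((bBack M (L ^ k) (ι := ι)) * ((cgrad M (L ^ k) (fun (_ : Fin (d + 1)) (_ : Tor (fine (L ^ k) M)) => (1 : Matrix ι ι ℝ))) * (cGreen M (L ^ k) (fun (_ : Fin (d + 1)) (_ : Tor (fine (L ^ k) M)) => (1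 : Matrix ι ι ℝ)) a))) - Matrix.mulVecLin (bContr M (L ^ k) (fun ν x => (((L ^ k : ℕ) : ℝ)) • ((1 : Matrix ι ι ℝ) - T ν x))) ∘ₗ Matrix.mulVecLin ((cgrad M (L ^ k) (fun (_ : Fin (d + 1)) (_ : Tor (fine (L ^ k) M)) => (1 : Matrix ι ι ℝ))) * (cGreen M (L ^ k) (fun (_ : Fin (d + 1)) (_ : Tor (fine (L ^ k) M)) => (1 : Matrix ι ι ℝ)) a))) + (Matrix.mulVecLin (bContr M (L ^ k) (fun μ z => ((((L ^ k : ℕ) : ℝ)) • ((1 : Matrix ι ι ℝ) - T μ (z - unitVec (fine (L ^ k) M) μ)))ᵀ)) ∘ₗ Matrix.mulVecLin ((bBack M (L ^ k) (ι := ι)) * ((cgrad M (L ^ k) (fun (_ : Fin (d + 1)) (_ : Tor (fine (L ^ k) M)) => (1 : Matrix ι ι ℝ))) * (cGreen M (L ^ k) (fun (_ : Fin (d + 1)) (_ : Tor (fine (L ^ k) M)) => (1 : Matrix ι ι ℝ)) a))) - Matrix.mulVecLin (bContr M (L ^ k) (fun ν x => (((L ^ k : ℕ) : ℝ)) • ((1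 : Matrix ι ι ℝ) - T ν x))) ∘ₗ Matrix.mulVecLin ((cgrad M (L ^ k) (fun (_ : Fin (d + 1)) (_ : Tor (fine (L ^ k) M)) => (1 : Matrix ι ι ℝ))) * (cGreen M (L ^ k) (fun (_ : Fin (d + 1)) (_ : Tor (fine (L ^ k) M)) => (1 : Matrix ι ι ℝ)) a))) ∘ₗ ((Matrix.mulVecLin (sDiag M (L ^ k) (bDiv M (L ^ k) (fun ν x => (((L ^ k : ℕ) : ℝ)) • ((1 : Matrix ι ι ℝ) - T ν x)))) - Matrix.mulVecLin (sDiag M (L ^ k) (fun z => ∑ μ, ((fun ν x => (((L ^ k : ℕ) : ℝ)) • ((1 : Matrix ι ι ℝ) - T ν x)) μ (z - unitVec (fine (L ^ k) M) μ))ᵀ * (fun ν x => (((L ^ k : ℕ) : ℝ)) • ((1 : Matrix ι ι ℝ) - T ν x)) μ (z - unitVec (fine (L ^ k) M) μ))) + Matrix.mulVecLin (a • (((csavg M (L ^ k) (fun (_ : Fin (d + 1)) (_ : Tor (fine (L ^ k) M)) => (1 : Matrix ι ι ℝ))))ᵀ * (csavg M (L ^ k) (fun (_ : Fin (d + 1))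 (_ : Tor (fine (L ^ k) M)) => (1 : Matrix ι ι ℝ))) - ((csavg M (L ^ k) T))ᵀ * (csavg M (L ^ k) T)))) ∘ₗ Matrix.mulVecLin (cGreen M (L ^ k) T a))) + idef (pull (liftMap (kingPr L k m M) ι)) (pull (liftMap (kingPr L k m M) ι)) (Matrix.mulVecLin (bContr M (L ^ m * L ^ k) (fun μ z => ((((L ^ m * L ^ k : ℕ) : ℝ)) • ((1 : Matrix ι ι ℝ) - T' μ (z - unitVec (fine (L ^ m * L ^ k) M) μ)))ᵀ)) ∘ₗ Matrix.mulVecLin ((bBack M (L ^ m * L ^ k) (ι := ι)) * ((cgrad M (L ^ m * L ^ k) (fun (_ : Fin (d + 1)) (_ : Tor (fine (L ^ m * L ^ k) M)) => (1 : Matrix ι ι ℝ))) * (cGreen M (L ^ m * L ^ k) (fun (_ : Fin (d + 1)) (_ : Tor (fine (L ^ m * L ^ k) M)) => (1 : Matrix ι ι ℝ)) a'))) - Matrix.mulVecLin (bContr M (L ^ m * L ^ k) (fun ν x => (((L ^ m * L ^ k : ℕ) : ℝ)) • ((1 : Matrix ι ι ℝ) - T' ν x))) ∘ₗ Matrix.mulVecLin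 ((cgrad M (L ^ m * L ^ k) (fun (_ : Fin (d + 1)) (_ : Tor (fine (L ^ m * L ^ k) M)) => (1 : Matrix ι ι ℝ))) * (cGreen M (L ^ m * L ^ k) (fun (_ : Fin (d + 1)) (_ : Tor (fine (L ^ m * L ^ k) M)) => (1 : Matrix ι ι ℝ)) a'))) (Matrix.mulVecLin (bContr M (L ^ k) (fun μ z => ((((L ^ k : ℕ) : ℝ)) • ((1 : Matrix ι ι ℝ) - T μ (z - unitVec (fine (L ^ k) M) μ)))ᵀ)) ∘ₗ Matrix.mulVecLin ((bBack M (L ^ k) (ι := ι)) * ((cgrad M (L ^ k) (fun (_ : Fin (d + 1)) (_ : Tor (fine (L ^ k) M)) => (1 : Matrix ι ι ℝ))) * (cGreen M (L ^ k) (fun (_ : Fin (d + 1)) (_ : Tor (fine (L ^ k) M)) => (1 : Matrix ι ι ℝ)) a))) - Matrix.mulVecLin (bContr M (L ^ k) (fun ν x => (((L ^ k : ℕ) : ℝ)) • ((1 : Matrix ι ι ℝ) - T ν x))) ∘ₗ Matrix.mulVecLin ((cgrad M (L ^ k) (fun (_ : Fin (d + 1)) (_ : Tor (fine (L ^ k)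 M)) => (1 : Matrix ι ι ℝ))) * (cGreen M (L ^ k) (fun (_ : Fin (d + 1)) (_ : Tor (fine (L ^ k) M)) => (1 : Matrix ι ι ℝ)) a))) ∘ₗ ((Matrix.mulVecLin (((cgrad M (L ^ k) (fun (_ : Fin (d + 1)) (_ : Tor (fine (L ^ k) M)) => (1 : Matrix ι ι ℝ))) - cgrad M (L ^ k) T))ᵀ - Matrix.mulVecLin (bContr M (L ^ k) (fun ν x => (((L ^ k : ℕ) : ℝ)) • ((1 : Matrix ι ι ℝ) - T ν x)))) ∘ₗ Matrix.mulVecLin ((cgrad M (L ^ k) (fun (_ : Fin (d + 1)) (_ : Tor (fine (L ^ k) M)) => (1 : Matrix ι ι ℝ))) * (cGreen M (L ^ k) T a)))) (fun y y' => ((((d : ℝ) + 1) * ((((L ^ m * L ^ k : ℕ) : ℝ)) * ρ₁) * εDb + ((d : ℝ) + 1) * ωN * CDb + ((d : ℝ) + 1) * ((((L ^ m * L ^ k : ℕ) : ℝ)) * ρ₁) * εD + ((d : ℝ) + 1) * ωN * CD) + (((d : ℝ) + 1) * ((((L ^ m * L ^ k : ℕ) : ℝ)) * ρ₁) * (CDb₁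 + CD₁)) * ((((d : ℝ) + 1) * (((L ^ m * L ^ k : ℕ) : ℝ)) * ((((L ^ m * L ^ k : ℕ) : ℝ)) * lam₁) + ((d : ℝ) + 1) * (((((L ^ m * L ^ k : ℕ) : ℝ)) * ρ₁) * ((((L ^ m * L ^ k : ℕ) : ℝ)) * ρ₁)) + |a'| * (((((L ^ m * L ^ k : ℕ) : ℝ)) ^ (d + 1))⁻¹ * (σ₁ * τ₁ + σ₁))) * εX + (ωV + ωm + φQ) * CX) * c + (((d : ℝ) + 1) * ((((L ^ m * L ^ k : ℕ) : ℝ)) * ρ₁) * εDb + ((d : ℝ) + 1) * ωN * CDb + ((d : ℝ) + 1) * ((((L ^ m * L ^ k : ℕ) : ℝ)) * ρ₁) * εD + ((d : ℝ) + 1) * ωN * CD) * ((((d : ℝ) + 1) * (((L ^ k : ℕ) : ℝ)) * ((((L ^ k : ℕ) : ℝ)) * lam) + ((d : ℝ) + 1) * (((((L ^ k : ℕ) : ℝ)) * ρ) * ((((L ^ k : ℕ) : ℝ)) * ρ)) + |a| * (((((L ^ k : ℕ) : ℝ)) ^ (d + 1))⁻¹ * (σ * τ + σ))) * CX) * c +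 (((d : ℝ) + 1) * ((((L ^ m * L ^ k : ℕ) : ℝ)) * ρ₁) * εDb + ((d : ℝ) + 1) * ωN * CDb + ((d : ℝ) + 1) * ((((L ^ m * L ^ k : ℕ) : ℝ)) * ρ₁) * εD + ((d : ℝ) + 1) * ωN * CD) * (((((L ^ k : ℕ) : ℝ)) * ((d + 1 : ℕ) * ρ) * Real.exp (δ + s)) * CY * c + (((d : ℝ) + 1) * ((((L ^ k : ℕ) : ℝ)) * ρ)) * CY) * c) * Real.exp (-((δ - 2 * s) * tdistT M y y'))) := by
    rw [idef_add, idef_comp (pull (liftMap (kingPr L k m M) ι)) (pull (liftMap (kingPr L k m M) ι)) (pull (liftMap (kingPr L k m M) ι)) (Matrix.mulVecLin (bContr M (L ^ m * L ^ k) (fun μ z => ((((L ^ m * L ^ k : ℕ) : ℝ)) • ((1 : Matrix ι ι ℝ) - T' μ (z - unitVec (fine (L ^ m * L ^ k) M) μ)))ᵀ)) ∘ₗ Matrix.mulVecLin ((bBack M (L ^ m * L ^ k) (ι := ι)) * ((cgrad M (L ^ m * L ^ k) (fun (_ : Fin (d + 1)) (_ : Tor (fine (L ^ m * L ^ k) M))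 => (1 : Matrix ι ι ℝ))) * (cGreen M (L ^ m * L ^ k) (fun (_ : Fin (d + 1)) (_ : Tor (fine (L ^ m * L ^ k) M)) => (1 : Matrix ι ι ℝ)) a'))) - Matrix.mulVecLin (bContr M (L ^ m * L ^ k) (fun ν x => (((L ^ m * L ^ k : ℕ) : ℝ)) • ((1 : Matrix ι ι ℝ) - T' ν x))) ∘ₗ Matrix.mulVecLin ((cgrad M (L ^ m * L ^ k) (fun (_ : Fin (d + 1)) (_ : Tor (fine (L ^ m * L ^ k) M)) => (1 : Matrix ι ι ℝ))) * (cGreen M (L ^ m * L ^ k) (fun (_ : Fin (d + 1)) (_ : Tor (fine (L ^ m * L ^ k) M)) => (1 : Matrix ι ι ℝ)) a'))) ((Matrix.mulVecLin (sDiag M (L ^ m * L ^ k) (bDiv M (L ^ m * L ^ k) (fun ν x => (((L ^ m * L ^ k : ℕ) : ℝ)) • ((1 : Matrix ι ι ℝ) - T' ν x)))) - Matrix.mulVecLin (sDiag M (L ^ m * L ^ k) (fun z => ∑ μ, ((fun ν x => (((L ^ m * L ^ k : ℕ) : ℝ)) • ((1 : Matrix ι ι ℝ) - T' ν x)) μ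 (z - unitVec (fine (L ^ m * L ^ k) M) μ))ᵀ * (fun ν x => (((L ^ m * L ^ k : ℕ) : ℝ)) • ((1 : Matrix ι ι ℝ) - T' ν x)) μ (z - unitVec (fine (L ^ m * L ^ k) M) μ))) + Matrix.mulVecLin (a' • (((csavg M (L ^ m * L ^ k) (fun (_ : Fin (d + 1)) (_ : Tor (fine (L ^ m * L ^ k) M)) => (1 : Matrix ι ι ℝ))))ᵀ * (csavg M (L ^ m * L ^ k) (fun (_ : Fin (d + 1)) (_ : Tor (fine (L ^ m * L ^ k) M)) => (1 : Matrix ι ι ℝ))) - ((csavg M (L ^ m * L ^ k) T'))ᵀ * (csavg M (L ^ m * L ^ k) T')))) ∘ₗ Matrix.mulVecLin (cGreen M (L ^ m * L ^ k) T' a')) (Matrix.mulVecLin (bContr M (L ^ k) (fun μ z => ((((L ^ k : ℕ) : ℝ)) • ((1 : Matrix ι ι ℝ) - T μ (z - unitVec (fine (L ^ k) M) μ)))ᵀ)) ∘ₗ Matrix.mulVecLin ((bBack M (L ^ k) (ι := ι)) * ((cgrad M (L ^ k) (fun (_ : Fin (d + 1)) (_ : Tor (fine (L ^ k) M)) =>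 (1 : Matrix ι ι ℝ))) * (cGreen M (L ^ k) (fun (_ : Fin (d + 1)) (_ : Tor (fine (L ^ k) M)) => (1 : Matrix ι ι ℝ)) a))) - Matrix.mulVecLin (bContr M (L ^ k) (fun ν x => (((L ^ k : ℕ) : ℝ)) • ((1 : Matrix ι ι ℝ) - T ν x))) ∘ₗ Matrix.mulVecLin ((cgrad M (L ^ k) (fun (_ : Fin (d + 1)) (_ : Tor (fine (L ^ k) M)) => (1 : Matrix ι ι ℝ))) * (cGreen M (L ^ k) (fun (_ : Fin (d + 1)) (_ : Tor (fine (L ^ k) M)) => (1 : Matrix ι ι ℝ)) a))) ((Matrix.mulVecLin (sDiag M (L ^ k) (bDiv M (L ^ k) (fun ν x => (((L ^ k : ℕ) : ℝ)) • ((1 : Matrix ι ι ℝ) - T ν x)))) - Matrix.mulVecLin (sDiag M (L ^ k) (fun z => ∑ μ, ((fun ν x => (((L ^ k : ℕ) : ℝ)) • ((1 : Matrix ι ι ℝ) - T ν x)) μ (z - unitVec (fine (L ^ k) M) μ))ᵀ * (fun ν x => (((L ^ k : ℕ) : ℝ)) • ((1 : Matrix ι ι ℝ) - T ν x)) μ (z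 - unitVec (fine (L ^ k) M) μ))) + Matrix.mulVecLin (a • (((csavg M (L ^ k) (fun (_ : Fin (d + 1)) (_ : Tor (fine (L ^ k) M)) => (1 : Matrix ι ι ℝ))))ᵀ * (csavg M (L ^ k) (fun (_ : Fin (d + 1)) (_ : Tor (fine (L ^ k) M)) => (1 : Matrix ι ι ℝ))) - ((csavg M (L ^ k) T))ᵀ * (csavg M (L ^ k) T)))) ∘ₗ Matrix.mulVecLin (cGreen M (L ^ k) T a))]
    have e1 := (hasMaj_comp_exp (ρ := δ - s) htri hd hrow (by positivity) (by positivity) (by linarith) (by linarith) (by linarith) hKZ' hDW).of_rate_le hd (by rw [hκS1]; positivity) (by linarith : δ - 2 * s ≤ δ - s)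
    have e2 := (hasMaj_comp_exp (ρ := δ - s) htri hd hrow (by positivity) (by positivity) (by linarith) (by linarith) (by linarith) hDKZ hWG).of_rate_le hd (by rw [hκS]; positivity) (by linarith : δ - 2 * s ≤ δ - s)
    have e3 := (hasMaj_comp_exp (ρ := δ - s) htri hd hrow (by positivity) (by positivity) (by linarith) (by linarith) (by linarith) hDKZ hZrow).of_rate_le hd (by rw [hκS]; positivity) (by linarith : δ - 2 * s ≤ δ - s)
    have e0 := hDKZ.of_rate_le hd (by positivity) (by linarith : δ - 2 * s ≤ δ)
    refine ((e0.add (e1.add e2)).add e3).mono fun y y' => le_of_eq ?_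
    rw [hκS, hκS1]; ring
  have hfixD := idef_fix (pull (liftMap (kingPr L k m M) ι)) (pull (liftMap (kingPr L k m M) ι)) hfixZ hfixZ'
  obtain ⟨M₀, hM₀, hapZ⟩ := exists_const_hasMaj_ofBlocks (g := unitTorusGeo L k M) (liftBlk (blockOf (L ^ k) M) ι) (liftBlk (blockOf (L ^ m * L ^ k) M) ι) (idef (pull (liftMap (kingPr L k m M) ι)) (pull (liftMap (kingPr L k m M) ι)) ((Matrix.mulVecLin (((cgrad M (L ^ m * L ^ k) (fun (_ : Fin (d + 1)) (_ : Tor (fine (L ^ m * L ^ k) M)) => (1 : Matrix ι ι ℝ))) - cgrad M (L ^ m * L ^ k) T'))ᵀ - Matrix.mulVecLin (bContr M (L ^ m * L ^ k) (fun ν x => (((L ^ m * L ^ k : ℕ) : ℝ)) • ((1 : Matrix ι ι ℝ) - T' ν x)))) ∘ₗ Matrix.mulVecLin ((cgrad M (L ^ m * L ^ k) (fun (_ : Fin (d + 1)) (_ : Tor (fine (L ^ m * L ^ k) M)) => (1 : Matrix ι ι ℝ))) * (cGreen M (L ^ m * L ^ k) T' a'))) ((Matrix.mulVecLin (((cgrad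 M (L ^ k) (fun (_ : Fin (d + 1)) (_ : Tor (fine (L ^ k) M)) => (1 : Matrix ι ι ℝ))) - cgrad M (L ^ k) T))ᵀ - Matrix.mulVecLin (bContr M (L ^ k) (fun ν x => (((L ^ k : ℕ) : ℝ)) • ((1 : Matrix ι ι ℝ) - T ν x)))) ∘ₗ Matrix.mulVecLin ((cgrad M (L ^ k) (fun (_ : Fin (d + 1)) (_ : Tor (fine (L ^ k) M)) => (1 : Matrix ι ι ℝ))) * (cGreen M (L ^ k) T a))))
  have hθ0 : 0 ≤ (((d : ℝ) + 1) * ((((L ^ m * L ^ k : ℕ) : ℝ)) * ρ₁) * (CDb₁ + CD₁)) := by positivity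
  have hES0 : 0 ≤ ((((d : ℝ) + 1) * ((((L ^ m * L ^ k : ℕ) : ℝ)) * ρ₁) * εDb + ((d : ℝ) + 1) * ωN * CDb + ((d : ℝ) + 1) * ((((L ^ m * L ^ k : ℕ) : ℝ)) * ρ₁) * εD + ((d : ℝ) + 1) * ωN * CD) + (((d : ℝ) + 1) * ((((L ^ m * L ^ k : ℕ) : ℝ)) * ρ₁) * (CDb₁ + CD₁)) * ((((d : ℝ) + 1) * (((L ^ m * L ^ k : ℕ) : ℝ)) * ((((L ^ m * L ^ k : ℕ) : ℝ)) * lam₁) + ((d : ℝ) + 1) * (((((L ^ m * L ^ k : ℕ) : ℝ)) * ρ₁) * ((((L ^ m * L ^ k : ℕ) : ℝ)) * ρ₁)) + |a'| * (((((L ^ m * L ^ k : ℕ) : ℝ)) ^ (d + 1))⁻¹ * (σ₁ * τ₁ + σ₁))) * εX + (ωV + ωm + φQ) * CX) * c + (((d : ℝ) + 1) * ((((L ^ m * L ^ k : ℕ) : ℝ)) * ρ₁) * εDb + ((d : ℝ) + 1) * ωN * CDb + ((d : ℝ) + 1) * ((((L ^ m * L ^ k : ℕ) : ℝ)) * ρ₁)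 * εD + ((d : ℝ) + 1) * ωN * CD) * ((((d : ℝ) + 1) * (((L ^ k : ℕ) : ℝ)) * ((((L ^ k : ℕ) : ℝ)) * lam) + ((d : ℝ) + 1) * (((((L ^ k : ℕ) : ℝ)) * ρ) * ((((L ^ k : ℕ) : ℝ)) * ρ)) + |a| * (((((L ^ k : ℕ) : ℝ)) ^ (d + 1))⁻¹ * (σ * τ + σ))) * CX) * c + (((d : ℝ) + 1) * ((((L ^ m * L ^ k : ℕ) : ℝ)) * ρ₁) * εDb + ((d : ℝ) + 1) * ωN * CDb + ((d : ℝ) + 1) * ((((L ^ m * L ^ k : ℕ) : ℝ)) * ρ₁) * εD + ((d : ℝ) + 1) * ωN * CD) * (((((L ^ k : ℕ) : ℝ)) * ((d + 1 : ℕ) * ρ) * Real.exp (δ + s)) * CY * c + (((d : ℝ) + 1) * ((((L ^ k : ℕ) : ℝ)) * ρ)) * CY) * c) := by positivity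
  have hq'' : (BlockNorm.ofBlocks (unitTorusGeo L k M) (liftBlk (blockOf (L ^ m * L ^ k) M) ι)).κ * (((d : ℝ) + 1) * ((((L ^ m * L ^ k : ℕ) : ℝ)) * ρ₁) * (CDb₁ + CD₁)) * c < 1 := by rw [hκS1, one_mul]; exact hq'
  have hDZ : HasMaj (BlockNorm.ofBlocks (unitTorusGeo L k M) (liftBlk (blockOf (L ^ k) M) ι)) (BlockNorm.ofBlocks (unitTorusGeo L k M) (liftBlk (blockOf (L ^ m * L ^ k) M) ι)) (idef (pull (liftMap (kingPr L k m M) ι)) (pull (liftMap (kingPr L k m M) ι)) ((Matrix.mulVecLin (((cgrad M (L ^ m * L ^ k) (fun (_ : Fin (d + 1)) (_ : Tor (fine (L ^ m * L ^ k) M)) => (1 : Matrix ι ι ℝ))) - cgrad M (L ^ m * L ^ k) T'))ᵀ - Matrix.mulVecLin (bContr M (L ^ m * L ^ k) (fun ν x => (((L ^ m * L ^ k : ℕ) : ℝ)) • ((1 : Matrix ι ι ℝ) - T' ν x)))) ∘ₗ Matrix.mulVecLin ((cgrad M (L ^ m * L ^ k) (fun (_ : Fin (d + 1)) (_ : Tor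 (fine (L ^ m * L ^ k) M)) => (1 : Matrix ι ι ℝ))) * (cGreen M (L ^ m * L ^ k) T' a'))) ((Matrix.mulVecLin (((cgrad M (L ^ k) (fun (_ : Fin (d + 1)) (_ : Tor (fine (L ^ k) M)) => (1 : Matrix ι ι ℝ))) - cgrad M (L ^ k) T))ᵀ - Matrix.mulVecLin (bContr M (L ^ k) (fun ν x => (((L ^ k : ℕ) : ℝ)) • ((1 : Matrix ι ι ℝ) - T ν x)))) ∘ₗ Matrix.mulVecLin ((cgrad M (L ^ k) (fun (_ : Fin (d + 1)) (_ : Tor (fine (L ^ k) M)) => (1 : Matrix ι ι ℝ))) * (cGreen M (L ^ k) T a)))) (fun y y' => (((((d : ℝ) + 1) * ((((L ^ m * L ^ k : ℕ) : ℝ)) * ρ₁) * εDb + ((d : ℝ) + 1) * ωN * CDb + ((d : ℝ) + 1) * ((((L ^ m * L ^ k : ℕ) : ℝ)) * ρ₁) * εD + ((d : ℝ) + 1) * ωN * CD) + (((d : ℝ) + 1) * ((((L ^ m * L ^ k : ℕ) : ℝ)) * ρ₁) * (CDb₁ + CD₁)) * ((((d : ℝ) + 1) * (((L ^ m * L ^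 k : ℕ) : ℝ)) * ((((L ^ m * L ^ k : ℕ) : ℝ)) * lam₁) + ((d : ℝ) + 1) * (((((L ^ m * L ^ k : ℕ) : ℝ)) * ρ₁) * ((((L ^ m * L ^ k : ℕ) : ℝ)) * ρ₁)) + |a'| * (((((L ^ m * L ^ k : ℕ) : ℝ)) ^ (d + 1))⁻¹ * (σ₁ * τ₁ + σ₁))) * εX + (ωV + ωm + φQ) * CX) * c + (((d : ℝ) + 1) * ((((L ^ m * L ^ k : ℕ) : ℝ)) * ρ₁) * εDb + ((d : ℝ) + 1) * ωN * CDb + ((d : ℝ) + 1) * ((((L ^ m * L ^ k : ℕ) : ℝ)) * ρ₁) * εD + ((d : ℝ) + 1) * ωN * CD) * ((((d : ℝ) + 1) * (((L ^ k : ℕ) : ℝ)) * ((((L ^ k : ℕ) : ℝ)) * lam) + ((d : ℝ) + 1) * (((((L ^ k : ℕ) : ℝ)) * ρ) * ((((L ^ k : ℕ) : ℝ)) * ρ)) + |a| * (((((L ^ k : ℕ) : ℝ)) ^ (d + 1))⁻¹ * (σ * τ + σ))) * CX) * c + (((d : ℝ) + 1) * ((((L ^ m * L ^ k : ℕ) :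 ℝ)) * ρ₁) * εDb + ((d : ℝ) + 1) * ωN * CDb + ((d : ℝ) + 1) * ((((L ^ m * L ^ k : ℕ) : ℝ)) * ρ₁) * εD + ((d : ℝ) + 1) * ωN * CD) * (((((L ^ k : ℕ) : ℝ)) * ((d + 1 : ℕ) * ρ) * Real.exp (δ + s)) * CY * c + (((d : ℝ) + 1) * ((((L ^ k : ℕ) : ℝ)) * ρ)) * CY) * c) * (1 - (((d : ℝ) + 1) * ((((L ^ m * L ^ k : ℕ) : ℝ)) * ρ₁) * (CDb₁ + CD₁)) * c)⁻¹) * Real.exp (-((δ - 2 * s) * tdistT M y y'))) := by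
    have key := neumann_majorant (b₁ := (BlockNorm.ofBlocks (unitTorusGeo L k M) (liftBlk (blockOf (L ^ k) M) ι))) (b₂ := (BlockNorm.ofBlocks (unitTorusGeo L k M) (liftBlk (blockOf (L ^ m * L ^ k) M) ι))) (ρ := δ - 2 * s) htri hd hrow hθ0 hES0 hM₀ (by linarith) (by linarith) (hKZ'.of_rate_le hd hθ0 (by linarith : δ - s ≤ δ)) hSrcZ hfixD hapZ hq''
    exact key.mono fun y y' => le_of_eq (by rw [hκS1, one_mul])
  -- ### the gradient defect assembled: `𝔇(∂G′) = 𝔇(S₂′, S₂) + ∂′G′(1)′·𝔇(Z′, Z) + 𝔇(∂G′(1)′, ∂G′(1))·Z`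
  have hexpD : idef (pull (liftMap (kingPr L k m M) ι)) (pull (liftMap (kingPrV L k m M) ι)) (Matrix.mulVecLin ((cgrad M (L ^ m * L ^ k) (fun (_ : Fin (d + 1)) (_ : Tor (fine (L ^ m * L ^ k) M)) => (1 : Matrix ι ι ℝ))) * (cGreen M (L ^ m * L ^ k) T' a'))) (Matrix.mulVecLin ((cgrad M (L ^ k) (fun (_ : Fin (d + 1)) (_ : Tor (fine (L ^ k) M)) => (1 : Matrix ι ι ℝ))) * (cGreen M (L ^ k) T a))) =
      (idef (pull (liftMap (kingPr L k m M) ι)) (pull (liftMap (kingPrV L k m M) ι)) (Matrix.mulVecLin ((cgrad M (L ^ m * L ^ k) (fun (_ : Fin (d + 1)) (_ : Tor (fine (L ^ m * L ^ k) M)) => (1 : Matrix ι ι ℝ))) * (cGreen M (L ^ m * L ^ k) (fun (_ : Fin (d + 1)) (_ : Tor (fine (L ^ m * L ^ k) M)) => (1 : Matrix ι ι ℝ)) a'))) (Matrix.mulVecLin ((cgrad M (L ^ k) (fun (_ : Fin (d + 1)) (_ : Tor (fine (L ^ k) M)) => (1 : Matrix ι ι ℝ))) * (cGreen M (L ^ k)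 (fun (_ : Fin (d + 1)) (_ : Tor (fine (L ^ k) M)) => (1 : Matrix ι ι ℝ)) a)))
        + (Matrix.mulVecLin ((cgrad M (L ^ m * L ^ k) (fun (_ : Fin (d + 1)) (_ : Tor (fine (L ^ m * L ^ k) M)) => (1 : Matrix ι ι ℝ))) * (cGreen M (L ^ m * L ^ k) (fun (_ : Fin (d + 1)) (_ : Tor (fine (L ^ m * L ^ k) M)) => (1 : Matrix ι ι ℝ)) a')) ∘ₗ idef (pull (liftMap (kingPr L k m M) ι)) (pull (liftMap (kingPr L k m M) ι)) ((Matrix.mulVecLin (sDiag M (L ^ m * L ^ k) (bDiv M (L ^ m * L ^ k) (fun ν x => (((L ^ m * L ^ k : ℕ) : ℝ)) • ((1 : Matrix ι ι ℝ) - T' ν x)))) - Matrix.mulVecLin (sDiag M (L ^ m * L ^ k) (fun z => ∑ μ, ((fun ν x => (((L ^ m * L ^ k : ℕ) : ℝ)) • ((1 : Matrix ι ι ℝ) - T' ν x)) μ (z - unitVec (fine (L ^ m * L ^ k) M) μ))ᵀ * (fun ν x => (((L ^ m * L ^ k : ℕ) : ℝ)) • ((1 : Matrix ι ι ℝ) -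 T' ν x)) μ (z - unitVec (fine (L ^ m * L ^ k) M) μ))) + Matrix.mulVecLin (a' • (((csavg M (L ^ m * L ^ k) (fun (_ : Fin (d + 1)) (_ : Tor (fine (L ^ m * L ^ k) M)) => (1 : Matrix ι ι ℝ))))ᵀ * (csavg M (L ^ m * L ^ k) (fun (_ : Fin (d + 1)) (_ : Tor (fine (L ^ m * L ^ k) M)) => (1 : Matrix ι ι ℝ))) - ((csavg M (L ^ m * L ^ k) T'))ᵀ * (csavg M (L ^ m * L ^ k) T')))) ∘ₗ Matrix.mulVecLin (cGreen M (L ^ m * L ^ k) T' a')) ((Matrix.mulVecLin (sDiag M (L ^ k) (bDiv M (L ^ k) (fun ν x => (((L ^ k : ℕ) : ℝ)) • ((1 : Matrix ι ι ℝ) - T ν x)))) - Matrix.mulVecLin (sDiag M (L ^ k) (fun z => ∑ μ, ((fun ν x => (((L ^ k : ℕ) : ℝ)) • ((1 : Matrix ι ι ℝ) - T ν x)) μ (z - unitVec (fine (L ^ k) M) μ))ᵀ * (fun ν x => (((L ^ k : ℕ) : ℝ)) • ((1 : Matrix ι ι ℝ) - T ν x)) μ (z - unitVec (fine (L ^ k)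 M) μ))) + Matrix.mulVecLin (a • (((csavg M (L ^ k) (fun (_ : Fin (d + 1)) (_ : Tor (fine (L ^ k) M)) => (1 : Matrix ι ι ℝ))))ᵀ * (csavg M (L ^ k) (fun (_ : Fin (d + 1)) (_ : Tor (fine (L ^ k) M)) => (1 : Matrix ι ι ℝ))) - ((csavg M (L ^ k) T))ᵀ * (csavg M (L ^ k) T)))) ∘ₗ Matrix.mulVecLin (cGreen M (L ^ k) T a)) + idef (pull (liftMap (kingPr L k m M) ι)) (pull (liftMap (kingPrV L k m M) ι)) (Matrix.mulVecLin ((cgrad M (L ^ m * L ^ k) (fun (_ : Fin (d + 1)) (_ : Tor (fine (L ^ m * L ^ k) M)) => (1 : Matrix ι ι ℝ))) * (cGreen M (L ^ m * L ^ k) (fun (_ : Fin (d + 1)) (_ : Tor (fine (L ^ m * L ^ k) M)) => (1 : Matrix ι ι ℝ)) a'))) (Matrix.mulVecLin ((cgrad M (L ^ k) (fun (_ : Fin (d + 1)) (_ : Tor (fine (L ^ k) M)) => (1 : Matrix ι ι ℝ))) * (cGreen M (L ^ k) (fun (_ : Fin (d + 1)) (_ : Tor (fine (L ^ k) M)) =>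 (1 : Matrix ι ι ℝ)) a))) ∘ₗ ((Matrix.mulVecLin (sDiag M (L ^ k) (bDiv M (L ^ k) (fun ν x => (((L ^ k : ℕ) : ℝ)) • ((1 : Matrix ι ι ℝ) - T ν x)))) - Matrix.mulVecLin (sDiag M (L ^ k) (fun z => ∑ μ, ((fun ν x => (((L ^ k : ℕ) : ℝ)) • ((1 : Matrix ι ι ℝ) - T ν x)) μ (z - unitVec (fine (L ^ k) M) μ))ᵀ * (fun ν x => (((L ^ k : ℕ) : ℝ)) • ((1 : Matrix ι ι ℝ) - T ν x)) μ (z - unitVec (fine (L ^ k) M) μ))) + Matrix.mulVecLin (a • (((csavg M (L ^ k) (fun (_ : Fin (d + 1)) (_ : Tor (fine (L ^ k) M)) => (1 : Matrix ι ι ℝ))))ᵀ * (csavg M (L ^ k) (fun (_ : Fin (d + 1)) (_ : Tor (fine (L ^ k) M)) => (1 : Matrix ι ι ℝ))) - ((csavg M (L ^ k) T))ᵀ * (csavg M (L ^ k) T)))) ∘ₗ Matrix.mulVecLin (cGreen M (L ^ k) T a))))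
      + (Matrix.mulVecLin ((cgrad M (L ^ m * L ^ k) (fun (_ : Fin (d + 1)) (_ : Tor (fine (L ^ m * L ^ k) M)) => (1 : Matrix ι ι ℝ))) * (cGreen M (L ^ m * L ^ k) (fun (_ : Fin (d + 1)) (_ : Tor (fine (L ^ m * L ^ k) M)) => (1 : Matrix ι ι ℝ)) a')) ∘ₗ idef (pull (liftMap (kingPr L k m M) ι)) (pull (liftMap (kingPr L k m M) ι)) ((Matrix.mulVecLin (((cgrad M (L ^ m * L ^ k) (fun (_ : Fin (d + 1)) (_ : Tor (fine (L ^ m * L ^ k) M)) => (1 : Matrix ι ι ℝ))) - cgrad M (L ^ m * L ^ k) T'))ᵀ - Matrix.mulVecLin (bContr M (L ^ m * L ^ k) (fun ν x => (((L ^ m * L ^ k : ℕ) : ℝ)) • ((1 : Matrix ι ι ℝ) - T' ν x)))) ∘ₗ Matrix.mulVecLin ((cgrad M (L ^ m * L ^ k) (fun (_ : Fin (d + 1)) (_ : Tor (fine (L ^ m * L ^ k) M)) => (1 : Matrix ι ι ℝ))) * (cGreen M (L ^ m * L ^ k) T' a'))) ((Matrix.mulVecLin (((cgrad M (L ^ k)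 (fun (_ : Fin (d + 1)) (_ : Tor (fine (L ^ k) M)) => (1 : Matrix ι ι ℝ))) - cgrad M (L ^ k) T))ᵀ - Matrix.mulVecLin (bContr M (L ^ k) (fun ν x => (((L ^ k : ℕ) : ℝ)) • ((1 : Matrix ι ι ℝ) - T ν x)))) ∘ₗ Matrix.mulVecLin ((cgrad M (L ^ k) (fun (_ : Fin (d + 1)) (_ : Tor (fine (L ^ k) M)) => (1 : Matrix ι ι ℝ))) * (cGreen M (L ^ k) T a))) + idef (pull (liftMap (kingPr L k m M) ι)) (pull (liftMap (kingPrV L k m M) ι)) (Matrix.mulVecLin ((cgrad M (L ^ m * L ^ k) (fun (_ : Fin (d + 1)) (_ : Tor (fine (L ^ m * L ^ k) M)) => (1 : Matrix ι ι ℝ))) * (cGreen M (L ^ m * L ^ k) (fun (_ : Fin (d + 1)) (_ : Tor (fine (L ^ m * L ^ k) M)) => (1 : Matrix ι ι ℝ)) a'))) (Matrix.mulVecLin ((cgrad M (L ^ k) (fun (_ : Fin (d + 1)) (_ : Tor (fine (L ^ k) M)) => (1 : Matrix ι ι ℝ))) * (cGreen M (L ^ k) (fun (_ : Fin (d + 1))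 (_ : Tor (fine (L ^ k) M)) => (1 : Matrix ι ι ℝ)) a))) ∘ₗ ((Matrix.mulVecLin (((cgrad M (L ^ k) (fun (_ : Fin (d + 1)) (_ : Tor (fine (L ^ k) M)) => (1 : Matrix ι ι ℝ))) - cgrad M (L ^ k) T))ᵀ - Matrix.mulVecLin (bContr M (L ^ k) (fun ν x => (((L ^ k : ℕ) : ℝ)) • ((1 : Matrix ι ι ℝ) - T ν x)))) ∘ₗ Matrix.mulVecLin ((cgrad M (L ^ k) (fun (_ : Fin (d + 1)) (_ : Tor (fine (L ^ k) M)) => (1 : Matrix ι ι ℝ))) * (cGreen M (L ^ k) T a)))) := by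
    conv_lhs => rw [hA1', hA1, idef_add, idef_add, idef_comp (pull (liftMap (kingPr L k m M) ι)) (pull (liftMap (kingPr L k m M) ι)) (pull (liftMap (kingPrV L k m M) ι)) (Matrix.mulVecLin ((cgrad M (L ^ m * L ^ k) (fun (_ : Fin (d + 1)) (_ : Tor (fine (L ^ m * L ^ k) M)) => (1 : Matrix ι ι ℝ))) * (cGreen M (L ^ m * L ^ k) (fun (_ : Fin (d + 1)) (_ : Tor (fine (L ^ m * L ^ k) M)) => (1 : Matrix ι ι ℝ)) a'))) ((Matrix.mulVecLin (sDiag M (L ^ m * L ^ k) (bDiv M (L ^ m * L ^ k) (fun ν x => (((L ^ m * L ^ k : ℕ) : ℝ)) • ((1 : Matrix ι ι ℝ) - T' ν x)))) - Matrix.mulVecLin (sDiag M (L ^ m * L ^ k) (fun z => ∑ μ, ((fun ν x => (((L ^ m * L ^ k : ℕ) : ℝ)) • ((1 : Matrix ι ι ℝ) - T' ν x)) μ (z - unitVec (fine (L ^ m * L ^ k) M) μ))ᵀ * (fun ν x => (((L ^ m * L ^ k : ℕ) : ℝ)) • ((1 : Matrix ι ι ℝ) - T' ν x)) μ (z - unitVec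 (fine (L ^ m * L ^ k) M) μ))) + Matrix.mulVecLin (a' • (((csavg M (L ^ m * L ^ k) (fun (_ : Fin (d + 1)) (_ : Tor (fine (L ^ m * L ^ k) M)) => (1 : Matrix ι ι ℝ))))ᵀ * (csavg M (L ^ m * L ^ k) (fun (_ : Fin (d + 1)) (_ : Tor (fine (L ^ m * L ^ k) M)) => (1 : Matrix ι ι ℝ))) - ((csavg M (L ^ m * L ^ k) T'))ᵀ * (csavg M (L ^ m * L ^ k) T')))) ∘ₗ Matrix.mulVecLin (cGreen M (L ^ m * L ^ k) T' a')) (Matrix.mulVecLin ((cgrad M (L ^ k) (fun (_ : Fin (d + 1)) (_ : Tor (fine (L ^ k) M)) => (1 : Matrix ι ι ℝ))) * (cGreen M (L ^ k) (fun (_ : Fin (d + 1)) (_ : Tor (fine (L ^ k) M)) => (1 : Matrix ι ι ℝ)) a))) ((Matrix.mulVecLin (sDiag M (L ^ k) (bDiv M (L ^ k) (fun ν x => (((L ^ k : ℕ) : ℝ)) • ((1 : Matrix ι ι ℝ) - T ν x)))) - Matrix.mulVecLin (sDiag M (L ^ k) (fun z => ∑ μ, ((fun ν x => (((L ^ k :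 ℕ) : ℝ)) • ((1 : Matrix ι ι ℝ) - T ν x)) μ (z - unitVec (fine (L ^ k) M) μ))ᵀ * (fun ν x => (((L ^ k : ℕ) : ℝ)) • ((1 : Matrix ι ι ℝ) - T ν x)) μ (z - unitVec (fine (L ^ k) M) μ))) + Matrix.mulVecLin (a • (((csavg M (L ^ k) (fun (_ : Fin (d + 1)) (_ : Tor (fine (L ^ k) M)) => (1 : Matrix ι ι ℝ))))ᵀ * (csavg M (L ^ k) (fun (_ : Fin (d + 1)) (_ : Tor (fine (L ^ k) M)) => (1 : Matrix ι ι ℝ))) - ((csavg M (L ^ k) T))ᵀ * (csavg M (L ^ k) T)))) ∘ₗ Matrix.mulVecLin (cGreen M (L ^ k) T a)),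
      idef_comp (pull (liftMap (kingPr L k m M) ι)) (pull (liftMap (kingPr L k m M) ι)) (pull (liftMap (kingPrV L k m M) ι)) (Matrix.mulVecLin ((cgrad M (L ^ m * L ^ k) (fun (_ : Fin (d + 1)) (_ : Tor (fine (L ^ m * L ^ k) M)) => (1 : Matrix ι ι ℝ))) * (cGreen M (L ^ m * L ^ k) (fun (_ : Fin (d + 1)) (_ : Tor (fine (L ^ m * L ^ k) M)) => (1 : Matrix ι ι ℝ)) a'))) ((Matrix.mulVecLin (((cgrad M (L ^ m * L ^ k) (fun (_ : Fin (d + 1)) (_ : Tor (fine (L ^ m * L ^ k) M)) => (1 : Matrix ι ι ℝ))) - cgrad M (L ^ m * L ^ k) T'))ᵀ - Matrix.mulVecLin (bContr M (L ^ m * L ^ k) (fun ν x => (((L ^ m * L ^ k : ℕ) : ℝ)) • ((1 : Matrix ι ι ℝ) - T' ν x)))) ∘ₗ Matrix.mulVecLin ((cgrad M (L ^ m * L ^ k) (fun (_ : Fin (d + 1)) (_ : Tor (fine (L ^ m * L ^ k) M)) => (1 : Matrix ι ι ℝ))) * (cGreen M (L ^ m * L ^ k) T' a'))) (Matrix.mulVecLin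 ((cgrad M (L ^ k) (fun (_ : Fin (d + 1)) (_ : Tor (fine (L ^ k) M)) => (1 : Matrix ι ι ℝ))) * (cGreen M (L ^ k) (fun (_ : Fin (d + 1)) (_ : Tor (fine (L ^ k) M)) => (1 : Matrix ι ι ℝ)) a))) ((Matrix.mulVecLin (((cgrad M (L ^ k) (fun (_ : Fin (d + 1)) (_ : Tor (fine (L ^ k) M)) => (1 : Matrix ι ι ℝ))) - cgrad M (L ^ k) T))ᵀ - Matrix.mulVecLin (bContr M (L ^ k) (fun ν x => (((L ^ k : ℕ) : ℝ)) • ((1 : Matrix ι ι ℝ) - T ν x)))) ∘ₗ Matrix.mulVecLin ((cgrad M (L ^ k) (fun (_ : Fin (d + 1)) (_ : Tor (fine (L ^ k) M)) => (1 : Matrix ι ι ℝ))) * (cGreen M (L ^ k) T a)))]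
  have hEZ0 : 0 ≤ (((((d : ℝ) + 1) * ((((L ^ m * L ^ k : ℕ) : ℝ)) * ρ₁) * εDb + ((d : ℝ) + 1) * ωN * CDb + ((d : ℝ) + 1) * ((((L ^ m * L ^ k : ℕ) : ℝ)) * ρ₁) * εD + ((d : ℝ) + 1) * ωN * CD) + (((d : ℝ) + 1) * ((((L ^ m * L ^ k : ℕ) : ℝ)) * ρ₁) * (CDb₁ + CD₁)) * ((((d : ℝ) + 1) * (((L ^ m * L ^ k : ℕ) : ℝ)) * ((((L ^ m * L ^ k : ℕ) : ℝ)) * lam₁) + ((d : ℝ) + 1) * (((((L ^ m * L ^ k : ℕ) : ℝ)) * ρ₁) * ((((L ^ m * L ^ k : ℕ) : ℝ)) * ρ₁)) + |a'| * (((((L ^ m * L ^ k : ℕ) : ℝ)) ^ (d + 1))⁻¹ * (σ₁ * τ₁ + σ₁))) * εX + (ωV + ωm + φQ) * CX) * c + (((d : ℝ) + 1) * ((((L ^ m * L ^ k : ℕ) : ℝ)) * ρ₁) * εDb + ((d : ℝ) + 1) * ωN * CDb + ((d : ℝ) + 1) * ((((L ^ m * L ^ k : ℕ) : ℝ)) *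 ρ₁) * εD + ((d : ℝ) + 1) * ωN * CD) * ((((d : ℝ) + 1) * (((L ^ k : ℕ) : ℝ)) * ((((L ^ k : ℕ) : ℝ)) * lam) + ((d : ℝ) + 1) * (((((L ^ k : ℕ) : ℝ)) * ρ) * ((((L ^ k : ℕ) : ℝ)) * ρ)) + |a| * (((((L ^ k : ℕ) : ℝ)) ^ (d + 1))⁻¹ * (σ * τ + σ))) * CX) * c + (((d : ℝ) + 1) * ((((L ^ m * L ^ k : ℕ) : ℝ)) * ρ₁) * εDb + ((d : ℝ) + 1) * ωN * CDb + ((d : ℝ) + 1) * ((((L ^ m * L ^ k : ℕ) : ℝ)) * ρ₁) * εD + ((d : ℝ) + 1) * ωN * CD) * (((((L ^ k : ℕ) : ℝ)) * ((d + 1 : ℕ) * ρ) * Real.exp (δ + s)) * CY * c + (((d : ℝ) + 1) * ((((L ^ k : ℕ) : ℝ)) * ρ)) * CY) * c) * (1 - (((d : ℝ) + 1) * ((((L ^ m * L ^ k : ℕ) : ℝ)) * ρ₁) * (CDb₁ + CD₁)) * c)⁻¹) := mul_nonneg hES0 (inv_nonneg.mpr (sub_nonneg.mpr (le_of_lt (by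 simpa only [hκS1, one_mul] using hq''))))
  rw [hexpD]
  have f0 := hDD.of_rate_le hd hεD (by linarith : δ - 3 * s ≤ δ)
  have f1 := (hasMaj_comp_exp (ρ := δ - s) htri hd hrow hCD₁ (by positivity) (by linarith) (by linarith) (by linarith) hD1' hDW).of_rate_le hd (by rw [hκS1]; positivity) (by linarith : δ - 3 * s ≤ δ - s)
  have f2 := (hasMaj_comp_exp (ρ := δ - s) htri hd hrow hεD (by positivity) (by linarith) (by linarith) (by linarith) hDD hWG).of_rate_le hd (by rw [hκS]; positivity) (by linarith : δ - 3 * s ≤ δ - s)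
  have f3 := hasMaj_comp_exp (ρ := δ - 3 * s) htri hd hrow hCD₁ hEZ0 (by linarith) (by linarith) (by linarith) hD1' hDZ
  have f4 := (hasMaj_comp_exp (ρ := δ - s) htri hd hrow hεD (by positivity) (by linarith) (by linarith) (by linarith) hDD hZrow).of_rate_le hd (by rw [hκS]; positivity) (by linarith : δ - 3 * s ≤ δ - s)
  refine ((f0.add (f1.add f2)).add (f3.add f4)).mono fun y y' => le_of_eq ?_
  rw [hκS, hκS1]
  ring

end Defect

end Summit.QuantumFields.YangMills.BalabanUVNodes.N15.CovLandau

end
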